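import Mathlib
import HarnessLib
import Summits.Langlands.Statement
import Summits.Langlands.Langlands.Theses.CartanRankSplit
import Summits.Langlands.Langlands.Theorems.MonodromyDichotomyKroneckerPrimitivity
import Summits.Langlands.Langlands.Theorems.MonodromyDichotomyCartanRank

set_option linter.dupNamespace false

/-!
# MonodromyDichotomyInvariantForm — statement-and-kernel support module (tree twin of the decomp-langlands lens-2 gen-14 node `InvariantFormSplit`; `--supports stmt-Langlands-27772`)

The node header follows verbatim.  InvariantFormSplit — decomp-langlands lens-2 gen 14 (structural dichotomy «special vs generic», RESIDUAL MODE, BLOCKER FIRST)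

TARGET (a LAYER-2 DECLARED RESIDUAL of the cell, by name): STD = `CartanRankSplit.StandardTypeAutomorphy` (stmt-Langlands-27772, crux rank 4,
OPEN, the declared residual of route-Langlands-CartanRankSplit rev 0 @2269b3f6e41f — the child route born 2026-08-30 (bus L895) from NODE
lens-2-g13 under PRIM = `KroneckerPrimitivitySplit.SolvablyTensorPrimitiveAutomorphy` 27370, itself under H = `MonodromyDichotomy.HigherLieRankAutomorphy`
31222 of route-Langlands-MonodromyDichotomy rev 3).  STD = clause (B), in rank-induction form, for the irreducible pinned-geometric LIE-IRREDUCIBLE ρ of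
rank n ≥ 3 WITHOUT progression spectra, NOT solvably Kronecker, of CARTAN RANK ≥ ⌊n/2⌋ and NOT solvably an exterior square — on paper (small-module
classification, g13 memo §3): the derived connected monodromy group (G°)^der is SL_n (n ≥ 3), Sp_n (n ≥ 4) or SO_n (n ≥ 5, n ≠ 6) IN ITS NATURAL MODULE.

THESIS (lens 2 = special STRUCTURE vs GENERIC, read on the LAST classification datum a standard classical group carries in its natural module —
the INVARIANT BILINEAR FORM of the connected group — and on the LAST accidental isogeny not yet booked by the cell, B₂ = C₂):
 (I) the FORM DIAL `IsOfSelfDualType ρ`: «on some open neighbourhood U ∋ 1 of Γ_K an invertible J with ρ(g)ᵀ J ρ(g) = c_g · J for all g ∈ U» —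
     the CONNECTED monodromy group preserves a non-degenerate bilinear form up to similitude; on paper ⟺ (G°)^der ∈ {Sp_n, SO_n} (types B, C, D),
     its negation ⟺ (G°)^der = SL_n (type A_{n-1}, n ≥ 3: NO open subgroup is self-dual up to twist).  The set {g : ρ(g)ᵀ J ρ(g) ∈ 𝔾_m·J} is a closed
     SUBGROUP, so «contains an open neighbourhood of 1» = «is open»: the dial is INVARIANT under restriction to EVERY finite extension (both directions)
     and under ⊗χ (c_g absorbs χ(g)²) — orbit-closed with its complement under the whole print-transfer groupoid, no saturation needed (crit-1 rows 6/48/156);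
 (II) the SPIN WINDOW `IsRationalSpinWindow ρ` (B₂ = C₂: SO₅ ≅ Sp₄/μ₂ = PGSp₄, the 5-dimensional module = ∧²₀ of the 4-dimensional one): n = 5 and,
     for a rank-4 LIE FACTOR σ and pinned-geometric characters ψ, ν over K, ψ(g)·roots(charpoly ρ(g)) + {ν(g)} = {e_i e_j : i < j} ({e_i} = roots(charpoly
     σ(g))) for all g ∈ Γ_K — by Brauer–Nesbitt ρ ⊗ ψ ⊕ ν ≅ ∧²σ (σ is then GSp₄-valued with multiplier ν: the invariant line of ∧²σ IS the symplectic
     form); SATURATED over solvable Galois E ⊇ K as `IsSolvablySpinWindow ρ` for the bulk (the obstruction to a K-rational window is the Tate–Patrikis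
     lift Γ_K → SO₅(ℚ̄_ℓ) = PGSp₄ ↝ GSp₄, geometric over a CM quadratic extension [corpus:paper:arxiv-1207.6724 p.6 L20–21]: solvable).
So, inside STD:  WINDOW = the one remaining TRANSPORT from lower rank (clause (B) IS exterior-square functoriality GL₄ → GL₆ followed by the GL₁-peel,
given the rank-IH at m = 4), SELF-DUAL connected type = the θ-stable world (Arthur's endoscopic classification exists as a TARGET; potential
automorphy of single polarisable ρ in print; GSp₄ = abelian-surface type at n = 4 with BCGP), LINEAR connected type = the generic non-self-dual bulk
(«beyond twisted endoscopy» by definition: `Literature.Barriers.Langlands.TwistedEndoscopySelfDual`), the NEW DECLARED RESIDUAL.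

    STD ⟸ ACC₅ `SpinWindowTransport` [NEW · crux 2 · WEAKER · ATTACKABLE-NOW / CLOSABLE MOD PRINT + IH(4) + W⁺: K-rational spin window (n = 5); head =
              clause (B)'s own (irreducible ∧ pinned-geometric) + the rank-IH it consumes: IH(4) automorphy of σ on GL₄ (π₄) + π₄ ≅ π₄^∨ ⊗ ν by strong
              multiplicity one + Kim 2003 Thm A (∧²π₄ automorphic on GL₆, tree fact `Kim2003_exteriorSquare_GL4` with `…_archimedean.exists_lift_isLAlgebraic`)
              + the symplectic/orthogonal alternative decided on the GALOIS side (orthogonal type GO₄ = Rankin–Selberg product or Asai lift — Ramakrishnan —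
              would make σ Kronecker over a ≤ quadratic extension by the W⁺-avatars + Chebotarev + Brauer–Nesbitt, contradicting the ALTERNATING invariant
              line of the Lie-irreducible σ) + Asgari–Raghuram / Jacquet–Shalika: ∧²π₄ = ν ⊞ Π₅ isobaric (tree fact `AsgariRaghuram2007_notCuspidal_wedgeTwo_imp`)
              + cuspidality of Π₅ from the irreducibility of ρ via W⁺-avatars of the isobaric constituents + the twist by the Hecke character of ψ (CFT);
              NO descent, NO lifting: σ, ψ, ν are GIVEN over K]
      ∧  SD `SelfDualTypeAutomorphy` [NEW · crux 3 · WEAKER · UNDECIDED (instrumentable sub-locus named): STD-box, NOT solvably a spin window, of SELF-DUAL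
              connected type = (G°)^der ∈ {Sp_n (n ≥ 4 even), SO_n (n ≥ 7; n = 8 incl. triality images)} (+ the paper-empty slivers SO₅ without solvable
              spin window, SO₆ without solvable ∧²-structure): engines on sub-loci only — BLGGT potential automorphy of the single polarisable regular ρ over
              TR/CM K, automorphy lifting given residual automorphy, BCGP (n = 4, weight {0,0,1,1}, K TR: abelian-surface type, POTENTIAL modularity in
              print) — the census instrument is LMFDB genus-2 curves; Arthur 2013 supplies the automorphic target (discrete spectrum of SO_{n+1} / Sp_{n-1} /
              SO_n) but no Galois-to-automorphic engine over general K or irregular weight]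
      ∧  LIN `LinearTypeAutomorphy` [NEW · crux 4 · WEAKER · NEW DECLARED RESIDUAL · IDEA-NEEDED: STD-box, not solvably a spin window, NOT of self-dual
              connected type = (G°)^der = SL_n in its natural module, n ≥ 3 — the generic non-self-dual bulk (generic GL₃-motives, Picard-type and U(p,q)
              motives read over fields where they are not conjugate-self-dual, non-polarisable regular compatible systems): 10-author / Qian potential
              automorphy on the CM-regular sub-locus only; TwistedEndoscopySelfDual head-on]
      ∧  CSD `CartanRankSplit.CliffordSolvableDescent` [DEDUP-ATTACH stmt-Langlands-31695 (support, PRINT mod W⁺) — the ONE solvable descent, in the kernel,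
              on the saturated window]
      ∧  W⁺ `CartanRankSplit.SatakeAvatarExistence` [DEDUP-ATTACH stmt-Langlands-17415 (crux, OPEN, N0 core)]
      ∧  FRAME′ `StandardTypeFrame := STD → Langlands` [support · imported complement = the HOST ROUTE CartanRankSplit below STD (ACC 27770, SMALL 27771,
              CSD, W⁺, FRAME 27773) through its certified `CartanRankSplit.closes` (`frame_of_host`), further down KroneckerPrimitivitySplit rev 0
              (`frame_of_grandhost`, via the landed twin `Theorems.MonodromyDichotomyCartanRank.frame_of_host`) and MonodromyDichotomy rev 3]

EXACTNESS: ACC₅ → SD → LIN → STD modulo (W⁺ ∧ CSD) (`std_of_cells`: excluded middle on the SOLVABLE spin-window dial — on the window ACC₅ is run over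
the witness field E on ρ|_E (the rank-IH is field-universal; ACC₅'s head asks only irreducible ∧ pinned-geometric of ρ|_E, which the dial carries) and
the weak automorphy is descended E → K by CSD fed with W⁺ (ϑ := ρ|_E, rank-0 complement) — then excluded middle on the FORM dial over K itself (no
descent: the form type is restriction-invariant)); STD ⟹ SD ∧ LIN outright (`cells_of_std`: each is STD with two inserted hypotheses) and STD ⟹ ACC₅↾STD
(`cells_of_std'`, the STD-shaped window cell `SpinWindowCellExact`, implied by ACC₅: `exact_of_transport`); ACC₅ itself is hypothesis-minimal (= what
Kim's engine consumes) and Langlands-implied OUTRIGHT (`spinWindowTransport_of_langlands`: its head is clause (B)'s).  Langlands ⟺ (ACC₅ ∧ SD ∧ LIN)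
∧ CSD ∧ W⁺ ∧ FRAME′ (`langlands_iff_pieces`, EXACT mod NOTHING).  COSTUME census: 0 EQUIV pieces; every NEW piece WEAKER (`…_of_langlands`); CSD/W⁺/
FRAME′ are host items by name.  ORBIT CLOSURE: dial (I) is restriction- and twist-INVARIANT outright, dial (II) is SATURATED over solvable Galois E ⊇ K
(descent done once by CSD): no kernel-closable instance is booked in SD or LIN (the only print engine inside STD — the ∧²/peel transport — lives on the
window, and every solvably-rational window is in ACC₅'s orbit by construction).
WHY NOVEL (cell-relative): no node or route of record reads the INVARIANT BILINEAR FORM CLASS of the CONNECTED monodromy group — the datum separating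
type A_{n-1} from types B/C/D among the standard modules; lens-6's `PolarisationCarving` dial POL = «totally odd, essentially (conjugate-)self-dual
ρ₀ over a TR/CM field K₀ in a solvable sandwich» (BLGGT §2.1) is a DESCENT DATUM RELATIVE TO COMPLEX CONJUGATION over TR/CM fields, transversal to (I):
conjugate-self-dual unitary-type ρ over CM K are POL ∧ LIN, symplectic ρ over a mixed-signature K (or with even multiplier) are SD ∧ ¬POL; g13 read
the Cartan RANK, g12 ⊗-decomposability, g2/g3 connectedness / Lie rank, lens-4 Kronecker companions, lens-1/3/4 residual images; and the B₂ = C₂ spin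
window is the last accidental isogeny of the classical series not yet booked (A₁ = B₁ = C₁: host SYM; D₂ = A₁ × A₁: host KT; D₃ = A₃: g13 ACC; B₂ = C₂:
here; D₄-triality is an automorphism, not a transport) — invited by crit-1 row 174 advisory a3.
-/

namespace Summit.Langlands.Langlands.Theorems.MonodromyDichotomyInvariantForm

open Summit.Langlands.Langlands.Theses

open scoped BigOperators Classical Matrix
open Summit.Langlands.Langlands.Theorems.MonodromyDichotomyKroneckerPrimitivity (PinnedGeometric IsLieIrreducible HasProgressionSpectra InHigherLieRankBox IsLieFactor
  IsRationalKronecker IsSolvablyKronecker WeakAutomorphic RankIH trace_restrictField_eq_add_zero)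
open Summit.Langlands.Langlands.Theorems.MonodromyDichotomyCartanRank (InTensorPrimitiveBox HasRatioRankAtLeast IsRationalExteriorSquare IsSolvablyExteriorSquare)

/-! ## 1. Vocabulary (structured forms; the items in §4 inline them VERBATIM — `Iff.rfl` bridges in §5).  The H-box vocabulary is the landed twin
`Theorems.MonodromyDichotomyKroneckerPrimitivity` (p779554), the PRIM/STD-box vocabulary (`InTensorPrimitiveBox`, `HasRatioRankAtLeast`,
`IsRationalExteriorSquare`, `IsSolvablyExteriorSquare`) the landed twin `Theorems.MonodromyDichotomyCartanRank`, both opened by name. -/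
section Vocabulary
variable {K : Type} [Field K] [NumberField K] {ℓ : ℕ} [Fact ℓ.Prime] {n : ℕ}

/-- the STD-BOX over K: the PRIM-box (H-box ∧ not solvably Kronecker) AND Cartan rank ≥ ⌊n/2⌋ AND not solvably an exterior square — exactly STD's
hypotheses on ρ (documentation; the cells inline the clauses). -/
def InStandardBox (ρ : Literature.NumberTheory.GaloisRepresentations.FramedGaloisRep K (PadicAlgCl ℓ) n) : Prop :=
  InTensorPrimitiveBox ρ ∧ (HasRatioRankAtLeast ρ (n / 2) ∧ ¬ IsSolvablyExteriorSquare ρ)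

/-- DIAL (I) — SELF-DUAL CONNECTED TYPE: on some open neighbourhood U ∋ 1 of Γ_K there is an invertible matrix J with ρ(g)ᵀ J ρ(g) = c_g • J for
all g ∈ U.  On paper ⟺ the connected monodromy group preserves a non-degenerate bilinear form up to similitude ⟺ (G°)^der ∈ {Sp_n, SO_n} in the
natural module (Schur: J is then symmetric or alternating); invariant under every finite restriction (both directions) and under ⊗χ. -/
def IsOfSelfDualType (ρ : Literature.NumberTheory.GaloisRepresentations.FramedGaloisRep K (PadicAlgCl ℓ) n) : Prop :=
  (∃ U : Set (Field.absoluteGaloisGroup K), IsOpen U ∧ (1 : Field.absoluteGaloisGroup K) ∈ U ∧ ∃ J : Matrix (Fin n) (Fin n) (PadicAlgCl ℓ), IsUnit J.det ∧ ∀ g ∈ U, ∃ c : PadicAlgCl ℓ, (ρ g).val.transpose * J * (ρ g).val = c • J)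

/-- DIAL (II) over K itself — K-RATIONALLY A SPIN WINDOW (the accident B₂ = C₂): n = 5 and for a rank-4 LIE FACTOR σ and pinned-geometric characters
ψ, ν over K, ψ(g)·roots(charpoly ρ(g)) + {ν(g)} = {e_i e_j : i < j} ({e_i} = roots(charpoly σ(g))) for all g ∈ Γ_K — by Brauer–Nesbitt
ρ ⊗ ψ ⊕ ν ≅ ∧²σ, i.e. ρ ⊗ ψ is the 5-dimensional standard module of SO₅ = PGSp₄ pulled back along the GSp₄-valued σ. -/
def IsRationalSpinWindow (ρ : Literature.NumberTheory.GaloisRepresentations.FramedGaloisRep K (PadicAlgCl ℓ) n) : Prop :=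
  (n = 5 ∧ ∃ (σ : Literature.NumberTheory.GaloisRepresentations.FramedGaloisRep K (PadicAlgCl ℓ) 4) (ψ ν : Literature.NumberTheory.GaloisRepresentations.FramedGaloisRep K (PadicAlgCl ℓ) 1), (σ.toGaloisRep.IsIrreducible ∧ ((∀ᶠ v : IsDedekindDomain.HeightOneSpectrum (NumberField.RingOfIntegers K) in Filter.cofinite, σ.IsUnramifiedAt v) ∧ ∀ (v : IsDedekindDomain.HeightOneSpectrum (NumberField.RingOfIntegers K)) (hv : ((ℓ : ℕ) : NumberField.RingOfIntegers K) ∈ v.asIdeal), (Literature.NumberTheory.PAdicHodge.fontainePstAdicCompletion v ℓ hv).IsDeRhamFramed (σ.toLocal v)) ∧ (∀ (L : Type) [Field L] [NumberField L] [Algebra K L], (σ.restrictField L).toGaloisRep.IsIrreducible)) ∧ ∀ g : Field.absoluteGaloisGroup K, (Literature.NumberTheory.GaloisRepresentations.FramedRep.charpoly ρ g).roots.map (fun x => Literature.NumberTheory.GaloisRepresentations.FramedRep.trace ψ g * x) + {Literature.NumberTheory.GaloisRepresentations.FramedRep.trace ν g} = ((Literature.NumberTheory.GaloisRepresentations.FramedRep.charpoly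 σ g).roots.powersetCard 2).map Multiset.prod)

/-- THE SATURATED WINDOW DIAL — SOLVABLY A SPIN WINDOW: over some solvable Galois E/K, ρ|_E is irreducible, pinned-geometric and E-rationally a spin
window.  On paper = «(G°)^der ≅ SO₅ in its standard 5-dimensional module» (Tate–Patrikis: the lift Γ → SO₅ = PGSp₄ ↝ GSp₄ exists geometrically over a
CM quadratic extension); closed under ⊗χ, under restriction to solvable Galois L, and under descent. -/
def IsSolvablySpinWindow (ρ : Literature.NumberTheory.GaloisRepresentations.FramedGaloisRep K (PadicAlgCl ℓ) n) : Prop :=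
  ∃ (E : Type) (_ : Field E) (_ : NumberField E) (_ : Algebra K E), IsGalois K E ∧ IsSolvable (E ≃ₐ[K] E) ∧
    ((ρ.restrictField E).toGaloisRep.IsIrreducible ∧ PinnedGeometric (ρ.restrictField E)) ∧ IsRationalSpinWindow (ρ.restrictField E)

end Vocabulary

/-! ## 2. Certificates (kernel-checked arithmetic and linear algebra of the cut) -/
section Certificates

/-- the SPIN WINDOW sits INSIDE STD: ∧² of rank 4 has dimension C(4,2) = 6 = 5 + 1 (one GL₁-peel), rank SO₅ = 2 = ⌊5/2⌋ (LARGE: passes g13's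
Cartan-rank test), 5 is not a product a·b with a, b ≥ 2 (never Kronecker) and 5 ≠ 6 (off g13's D₃ = A₃ window). -/
theorem spin_window_arith : Nat.choose 4 2 = 5 + 1 ∧ 2 = 5 / 2 ∧ (∀ a ∈ Finset.Icc 2 5, ∀ b ∈ Finset.Icc 2 5, a * b ≠ 5) ∧ 5 ≠ 6 := by decide

/-- the accidental isogenies of the classical series, as dimensions, are ALL booked after this node: A₁ = B₁ = C₁ (3 = dim Sym²: host SYM cell),
D₂ = A₁ × A₁ (4 = 2·2: host KT cells), D₃ = A₃ (6 = C(4,2): g13 ACC), B₂ = C₂ (5 = C(4,2) − 1: ACC₅ here); D₄ (8) is a triality AUTOMORPHISM of one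
group, not a transport between two. -/
theorem accidents_booked : 3 = 2 + 1 ∧ 4 = 2 * 2 ∧ Nat.choose 4 2 = 6 ∧ Nat.choose 4 2 - 1 = 5 ∧ 8 = 2 * 4 := by decide

/-- every STANDARD type is LARGE in g13's sense (rank SL_n = n − 1 ≥ ⌊n/2⌋, rank Sp_n = rank SO_n = ⌊n/2⌋), n ≥ 3 (checked to 64). -/
theorem standard_types_large : ∀ n ∈ Finset.Icc 3 64, n / 2 ≤ n - 1 := by decide

/-- CONTENT of the form dial at odd rank: an invertible ALTERNATING matrix has even size — so at n = 5 (indeed at every odd n) a self-dual connected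
type is ORTHOGONAL, and the window's home B₂ is the whole self-dual story at rank 5 (char 0 coefficients). -/
theorem even_of_alternating_unit {R : Type} [CommRing R] [IsDomain R] [CharZero R] {m : ℕ}
    (J : Matrix (Fin m) (Fin m) R) (hJ : J.transpose = -J) (hdet : IsUnit J.det) : Even m := by
  rcases Nat.even_or_odd m with he | ho
  · exact he
  · exfalso
    have h1 : J.det = -J.det := by
      calc J.det = J.transpose.det := (Matrix.det_transpose J).symm
        _ = (-J).det := by rw [hJ]
        _ = (-1) ^ Fintype.card (Fin m) * J.det := Matrix.det_neg J
        _ = -J.det := by rw [Fintype.card_fin, ho.neg_one_pow]; ring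
    have h2 : (2 : R) * J.det = 0 := by linear_combination h1
    rcases mul_eq_zero.mp h2 with h | h
    · exact two_ne_zero h
    · exact hdet.ne_zero h

/-- the cut is exhaustive and its bulk cells are exclusive (excluded middle twice, recorded): window ∨ (¬window ∧ self-dual) ∨ (¬window ∧ ¬self-dual). -/
theorem cut_trichotomy (W F : Prop) : (W ∨ (¬ W ∧ F) ∨ (¬ W ∧ ¬ F)) ∧ ¬ ((¬ W ∧ F) ∧ (¬ W ∧ ¬ F)) := by
  constructor
  · by_cases hW : W
    · exact Or.inl hW
    · by_cases hF : F
      · exact Or.inr (Or.inl ⟨hW, hF⟩)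
      · exact Or.inr (Or.inr ⟨hW, hF⟩)
  · exact fun h => h.2.2 h.1.2

end Certificates

/-! ## 3. The target BY NAME and its text (identity certified by `Iff.rfl`) -/

/-- STD in structured form (= the twin's `standardTypeAutomorphy_iff`, stated for the ROUTE decl of record). -/
theorem target_iff : CartanRankSplit.StandardTypeAutomorphy ↔
    ∀ (K : Type) [Field K] [NumberField K] (n : ℕ) (hcpt : Literature.NumberTheory.Automorphic.isCompact_glFiniteIntegralLevel n K), 3 ≤ n → RankIH n →
      ∀ (ℓ : ℕ) [Fact ℓ.Prime] (ι : PadicAlgCl ℓ ≃+* ℂ) (ρ : Literature.NumberTheory.GaloisRepresentations.FramedGaloisRep K (PadicAlgCl ℓ) n), ρ.toGaloisRep.IsIrreducible → PinnedGeometric ρ →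
        IsLieIrreducible ρ → ¬ HasProgressionSpectra ρ → ¬ IsSolvablyKronecker ρ → (HasRatioRankAtLeast ρ (n / 2) ∧ ¬ IsSolvablyExteriorSquare ρ) →
          WeakAutomorphic hcpt ι ρ := Iff.rfl

/-- STD's tree text (route-Langlands-CartanRankSplit rev 0, 10054 chars) — the bulk cells below are this text with TWO inserted hypotheses each. -/
theorem target_text_iff : CartanRankSplit.StandardTypeAutomorphy ↔ ∀ (K : Type) [Field K] [NumberField K] (n : ℕ) (hcpt : Literature.NumberTheory.Automorphic.isCompact_glFiniteIntegralLevel n K), 3 ≤ n → (∀ (m : ℕ), 2 ≤ m → m < n → ∀ (E : Type) [Field E] [NumberField E] (hE : Literature.NumberTheory.Automorphic.isCompact_glFiniteIntegralLevel m E) (ℓ' : ℕ) [Fact ℓ'.Prime] (ι' : PadicAlgCl ℓ' ≃+* ℂ) (σ : Literature.NumberTheory.GaloisRepresentations.FramedGaloisRep E (PadicAlgCl ℓ') m), σ.toGaloisRep.IsIrreducible → ((∀ᶠ v : IsDedekindDomain.HeightOneSpectrum (NumberField.RingOfIntegers E) in Filter.cofinite, σ.IsUnramifiedAt v) ∧ ∀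 (v : IsDedekindDomain.HeightOneSpectrum (NumberField.RingOfIntegers E)) (hv : ((ℓ' : ℕ) : NumberField.RingOfIntegers E) ∈ v.asIdeal), (Literature.NumberTheory.PAdicHodge.fontainePstAdicCompletion v ℓ' hv).IsDeRhamFramed (σ.toLocal v)) → (∀ (L : Type) [Field L] [NumberField L] [Algebra E L], (σ.restrictField L).toGaloisRep.IsIrreducible) → ∃ π : Literature.NumberTheory.Automorphic.CuspidalAutomorphicRepData m E hE, π.1.IsLAlgebraic ∧ ∀ᶠ v : IsDedekindDomain.HeightOneSpectrum (NumberField.RingOfIntegers E) in Filter.cofinite, SatakeFrobCompatibleAt ι' π.1 σ v) → ∀ (ℓ : ℕ) [Fact ℓ.Prime] (ι : PadicAlgCl ℓ ≃+* ℂ) (ρ : Literature.NumberTheory.GaloisRepresentations.FramedGaloisRep K (PadicAlgCl ℓ) n), ρ.toGaloisRep.IsIrreducible → ((∀ᶠ v : IsDedekindDomain.HeightOneSpectrum (NumberField.RingOfIntegers K) in Filter.cofinite, ρ.IsUnramifiedAt v) ∧ ∀ (v : IsDedekindDomain.HeightOneSpectrum (NumberField.RingOfIntegers K)) (hv : ((ℓ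 : ℕ) : NumberField.RingOfIntegers K) ∈ v.asIdeal), (Literature.NumberTheory.PAdicHodge.fontainePstAdicCompletion v ℓ hv).IsDeRhamFramed (ρ.toLocal v)) → (∀ (L : Type) [Field L] [NumberField L] [Algebra K L], (ρ.restrictField L).toGaloisRep.IsIrreducible) → ¬ (∃ U : Set (Field.absoluteGaloisGroup K), IsOpen U ∧ (1 : Field.absoluteGaloisGroup K) ∈ U ∧ ∀ g ∈ U, ∃ c r : PadicAlgCl ℓ, Literature.NumberTheory.GaloisRepresentations.FramedRep.charpoly ρ g = ∏ j ∈ Finset.range n, (Polynomial.X - Polynomial.C (c * r ^ j))) → ¬ (∃ (E : Type) (_ : Field E) (_ : NumberField E) (_ : Algebra K E), IsGalois K E ∧ IsSolvable (E ≃ₐ[K] E) ∧ ((ρ.restrictField E).toGaloisRep.IsIrreducible ∧ ((∀ᶠ v : IsDedekindDomain.HeightOneSpectrum (NumberField.RingOfIntegers E) in Filter.cofinite, (ρ.restrictField E).IsUnramifiedAt v) ∧ ∀ (v : IsDedekindDomain.HeightOneSpectrum (NumberField.RingOfIntegers E)) (hv : ((ℓ : ℕ) : NumberField.RingOfIntegers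 E) ∈ v.asIdeal), (Literature.NumberTheory.PAdicHodge.fontainePstAdicCompletion v ℓ hv).IsDeRhamFramed ((ρ.restrictField E).toLocal v)) ∧ (∀ (L : Type) [Field L] [NumberField L] [Algebra E L], ((ρ.restrictField E).restrictField L).toGaloisRep.IsIrreducible) ∧ ¬ (∃ U : Set (Field.absoluteGaloisGroup E), IsOpen U ∧ (1 : Field.absoluteGaloisGroup E) ∈ U ∧ ∀ g ∈ U, ∃ c r : PadicAlgCl ℓ, Literature.NumberTheory.GaloisRepresentations.FramedRep.charpoly (ρ.restrictField E) g = ∏ j ∈ Finset.range n, (Polynomial.X - Polynomial.C (c * r ^ j)))) ∧ (∃ (a b : ℕ) (ρ₁ : Literature.NumberTheory.GaloisRepresentations.FramedGaloisRep E (PadicAlgCl ℓ) a) (ρ₂ : Literature.NumberTheory.GaloisRepresentations.FramedGaloisRep E (PadicAlgCl ℓ) b), 2 ≤ a ∧ 2 ≤ b ∧ n = a * b ∧ (ρ₁.toGaloisRep.IsIrreducible ∧ ((∀ᶠ v : IsDedekindDomain.HeightOneSpectrum (NumberField.RingOfIntegers E) in Filter.cofinite, ρ₁.IsUnramifiedAt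 v) ∧ ∀ (v : IsDedekindDomain.HeightOneSpectrum (NumberField.RingOfIntegers E)) (hv : ((ℓ : ℕ) : NumberField.RingOfIntegers E) ∈ v.asIdeal), (Literature.NumberTheory.PAdicHodge.fontainePstAdicCompletion v ℓ hv).IsDeRhamFramed (ρ₁.toLocal v)) ∧ (∀ (L : Type) [Field L] [NumberField L] [Algebra E L], (ρ₁.restrictField L).toGaloisRep.IsIrreducible)) ∧ (ρ₂.toGaloisRep.IsIrreducible ∧ ((∀ᶠ v : IsDedekindDomain.HeightOneSpectrum (NumberField.RingOfIntegers E) in Filter.cofinite, ρ₂.IsUnramifiedAt v) ∧ ∀ (v : IsDedekindDomain.HeightOneSpectrum (NumberField.RingOfIntegers E)) (hv : ((ℓ : ℕ) : NumberField.RingOfIntegers E) ∈ v.asIdeal), (Literature.NumberTheory.PAdicHodge.fontainePstAdicCompletion v ℓ hv).IsDeRhamFramed (ρ₂.toLocal v)) ∧ (∀ (L : Type) [Field L] [NumberField L] [Algebra E L], (ρ₂.restrictField L).toGaloisRep.IsIrreducible)) ∧ ∀ g : Field.absoluteGaloisGroup E, Literature.NumberTheory.GaloisRepresentations.FramedRep.charpoly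 (ρ.restrictField E) g = (Matrix.kroneckerMap (· * ·) ((ρ₁ g : GL (Fin a) (PadicAlgCl ℓ)) : Matrix (Fin a) (Fin a) (PadicAlgCl ℓ)) ((ρ₂ g : GL (Fin b) (PadicAlgCl ℓ)) : Matrix (Fin b) (Fin b) (PadicAlgCl ℓ))).charpoly)) → ((∀ U : Set (Field.absoluteGaloisGroup K), IsOpen U → (1 : Field.absoluteGaloisGroup K) ∈ U → ∃ g ∈ U, ∃ e : Fin n → PadicAlgCl ℓ, (Literature.NumberTheory.GaloisRepresentations.FramedRep.charpoly ρ g).roots = (Finset.univ : Finset (Fin n)).val.map e ∧ ∃ ij : Fin (n / 2) → Fin n × Fin n, ∀ a : Fin (n / 2) → ℤ, (∏ t : Fin (n / 2), (e (ij t).1 / e (ij t).2) ^ (a t)) = 1 → a = 0) ∧ ¬ (∃ (E : Type) (_ : Field E) (_ : NumberField E) (_ : Algebra K E), IsGalois K E ∧ IsSolvable (E ≃ₐ[K] E) ∧ (((ρ.restrictField E).toGaloisRep.IsIrreducible ∧ ((∀ᶠ v : IsDedekindDomain.HeightOneSpectrum (NumberField.RingOfIntegers E) in Filter.cofinite, (ρ.restrictField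 E).IsUnramifiedAt v) ∧ ∀ (v : IsDedekindDomain.HeightOneSpectrum (NumberField.RingOfIntegers E)) (hv : ((ℓ : ℕ) : NumberField.RingOfIntegers E) ∈ v.asIdeal), (Literature.NumberTheory.PAdicHodge.fontainePstAdicCompletion v ℓ hv).IsDeRhamFramed ((ρ.restrictField E).toLocal v)) ∧ (∀ (L : Type) [Field L] [NumberField L] [Algebra E L], ((ρ.restrictField E).restrictField L).toGaloisRep.IsIrreducible) ∧ ¬ (∃ U : Set (Field.absoluteGaloisGroup E), IsOpen U ∧ (1 : Field.absoluteGaloisGroup E) ∈ U ∧ ∀ g ∈ U, ∃ c r : PadicAlgCl ℓ, Literature.NumberTheory.GaloisRepresentations.FramedRep.charpoly (ρ.restrictField E) g = ∏ j ∈ Finset.range n, (Polynomial.X - Polynomial.C (c * r ^ j)))) ∧ ¬ (∃ (E' : Type) (_ : Field E') (_ : NumberField E') (_ : Algebra E E'), IsGalois E E' ∧ IsSolvable (E' ≃ₐ[E] E') ∧ (((ρ.restrictField E).restrictField E').toGaloisRep.IsIrreducible ∧ ((∀ᶠ v : IsDedekindDomain.HeightOneSpectrum (NumberField.RingOfIntegers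 E') in Filter.cofinite, ((ρ.restrictField E).restrictField E').IsUnramifiedAt v) ∧ ∀ (v : IsDedekindDomain.HeightOneSpectrum (NumberField.RingOfIntegers E')) (hv : ((ℓ : ℕ) : NumberField.RingOfIntegers E') ∈ v.asIdeal), (Literature.NumberTheory.PAdicHodge.fontainePstAdicCompletion v ℓ hv).IsDeRhamFramed (((ρ.restrictField E).restrictField E').toLocal v)) ∧ (∀ (L : Type) [Field L] [NumberField L] [Algebra E' L], (((ρ.restrictField E).restrictField E').restrictField L).toGaloisRep.IsIrreducible) ∧ ¬ (∃ U : Set (Field.absoluteGaloisGroup E'), IsOpen U ∧ (1 : Field.absoluteGaloisGroup E') ∈ U ∧ ∀ g ∈ U, ∃ c r : PadicAlgCl ℓ, Literature.NumberTheory.GaloisRepresentations.FramedRep.charpoly ((ρ.restrictField E).restrictField E') g = ∏ j ∈ Finset.range n, (Polynomial.X - Polynomial.C (c * r ^ j)))) ∧ (∃ (a b : ℕ) (ρ₁ : Literature.NumberTheory.GaloisRepresentations.FramedGaloisRep E' (PadicAlgCl ℓ) a) (ρ₂ : Literature.NumberTheory.GaloisRepresentations.FramedGaloisRep E' (PadicAlgCl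 ℓ) b), 2 ≤ a ∧ 2 ≤ b ∧ n = a * b ∧ (ρ₁.toGaloisRep.IsIrreducible ∧ ((∀ᶠ v : IsDedekindDomain.HeightOneSpectrum (NumberField.RingOfIntegers E') in Filter.cofinite, ρ₁.IsUnramifiedAt v) ∧ ∀ (v : IsDedekindDomain.HeightOneSpectrum (NumberField.RingOfIntegers E')) (hv : ((ℓ : ℕ) : NumberField.RingOfIntegers E') ∈ v.asIdeal), (Literature.NumberTheory.PAdicHodge.fontainePstAdicCompletion v ℓ hv).IsDeRhamFramed (ρ₁.toLocal v)) ∧ (∀ (L : Type) [Field L] [NumberField L] [Algebra E' L], (ρ₁.restrictField L).toGaloisRep.IsIrreducible)) ∧ (ρ₂.toGaloisRep.IsIrreducible ∧ ((∀ᶠ v : IsDedekindDomain.HeightOneSpectrum (NumberField.RingOfIntegers E') in Filter.cofinite, ρ₂.IsUnramifiedAt v) ∧ ∀ (v : IsDedekindDomain.HeightOneSpectrum (NumberField.RingOfIntegers E')) (hv : ((ℓ : ℕ) : NumberField.RingOfIntegers E') ∈ v.asIdeal), (Literature.NumberTheory.PAdicHodge.fontainePstAdicCompletion v ℓ hv).IsDeRhamFramed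 (ρ₂.toLocal v)) ∧ (∀ (L : Type) [Field L] [NumberField L] [Algebra E' L], (ρ₂.restrictField L).toGaloisRep.IsIrreducible)) ∧ ∀ g : Field.absoluteGaloisGroup E', Literature.NumberTheory.GaloisRepresentations.FramedRep.charpoly ((ρ.restrictField E).restrictField E') g = (Matrix.kroneckerMap (· * ·) ((ρ₁ g : GL (Fin a) (PadicAlgCl ℓ)) : Matrix (Fin a) (Fin a) (PadicAlgCl ℓ)) ((ρ₂ g : GL (Fin b) (PadicAlgCl ℓ)) : Matrix (Fin b) (Fin b) (PadicAlgCl ℓ))).charpoly))) ∧ (n = 6 ∧ ∃ (σ : Literature.NumberTheory.GaloisRepresentations.FramedGaloisRep E (PadicAlgCl ℓ) 4) (χ : Literature.NumberTheory.GaloisRepresentations.FramedGaloisRep E (PadicAlgCl ℓ) 1), (σ.toGaloisRep.IsIrreducible ∧ ((∀ᶠ v : IsDedekindDomain.HeightOneSpectrum (NumberField.RingOfIntegers E) in Filter.cofinite, σ.IsUnramifiedAt v) ∧ ∀ (v : IsDedekindDomain.HeightOneSpectrum (NumberField.RingOfIntegers E)) (hv : ((ℓ : ℕ) : NumberField.RingOfIntegers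 E) ∈ v.asIdeal), (Literature.NumberTheory.PAdicHodge.fontainePstAdicCompletion v ℓ hv).IsDeRhamFramed (σ.toLocal v)) ∧ (∀ (L : Type) [Field L] [NumberField L] [Algebra E L], (σ.restrictField L).toGaloisRep.IsIrreducible)) ∧ ((∀ᶠ v : IsDedekindDomain.HeightOneSpectrum (NumberField.RingOfIntegers E) in Filter.cofinite, χ.IsUnramifiedAt v) ∧ ∀ (v : IsDedekindDomain.HeightOneSpectrum (NumberField.RingOfIntegers E)) (hv : ((ℓ : ℕ) : NumberField.RingOfIntegers E) ∈ v.asIdeal), (Literature.NumberTheory.PAdicHodge.fontainePstAdicCompletion v ℓ hv).IsDeRhamFramed (χ.toLocal v)) ∧ ∀ g : Field.absoluteGaloisGroup E, (Literature.NumberTheory.GaloisRepresentations.FramedRep.charpoly (ρ.restrictField E) g).roots = (((Literature.NumberTheory.GaloisRepresentations.FramedRep.charpoly σ g).roots.powersetCard 2).map Multiset.prod).map (fun x => Literature.NumberTheory.GaloisRepresentations.FramedRep.trace χ g * x)))) → ∃ π : Literature.NumberTheory.Automorphic.CuspidalAutomorphicRepData n K hcpt, π.1.IsLAlgebraic ∧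 ∀ᶠ v : IsDedekindDomain.HeightOneSpectrum (NumberField.RingOfIntegers K) in Filter.cofinite, SatakeFrobCompatibleAt ι π.1 ρ v := Iff.rfl

/-- the route decl of record IS the landed twin's decl (g13 node = twin verbatim). -/
theorem target_iff_twin : CartanRankSplit.StandardTypeAutomorphy ↔ Summit.Langlands.Langlands.Theorems.MonodromyDichotomyCartanRank.StandardTypeAutomorphy := Iff.rfl

/-! ## 4. THE ITEMS (inlined one-liners over existing tree declarations = childroute.items.json `statement` VERBATIM) -/

/-- ACC₅ · crux 2 · WEAKER · ATTACKABLE-NOW (closable modulo print + IH(4) + W⁺: Kim's ∧² GL₄ → GL₆, the symplectic alternative, the GL₁-peel, the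
twist) — the ATTACKED CONJUNCT.  GIVEN W⁺ (the imported open crux `CartanRankSplit.SatakeAvatarExistence`, VERBATIM as the leading hypothesis — exactly
as CSD is «print mod W⁺») and the rank-IH, clause (B) for the irreducible pinned-geometric ρ that are K-RATIONALLY A SPIN WINDOW (n = 5).  Hypothesis-minimal
otherwise: the head is clause (B)'s own. -/
def SpinWindowTransport : Prop :=
  Summit.Langlands.Langlands.Theses.CartanRankSplit.SatakeAvatarExistence → ∀ (K : Type) [Field K] [NumberField K] (n : ℕ) (hcpt : Literature.NumberTheory.Automorphic.isCompact_glFiniteIntegralLevel n K), 3 ≤ n → (∀ (m : ℕ), 2 ≤ m → m < n → ∀ (E : Type) [Field E] [NumberField E] (hE : Literature.NumberTheory.Automorphic.isCompact_glFiniteIntegralLevel m E) (ℓ' : ℕ) [Fact ℓ'.Prime] (ι' : PadicAlgCl ℓ' ≃+* ℂ) (σ : Literature.NumberTheory.GaloisRepresentations.FramedGaloisRep E (PadicAlgCl ℓ') m), σ.toGaloisRep.IsIrreducible → ((∀ᶠ v : IsDedekindDomain.HeightOneSpectrum (NumberField.RingOfIntegers E) in Filter.cofinite, σ.IsUnramifiedAt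 v) ∧ ∀ (v : IsDedekindDomain.HeightOneSpectrum (NumberField.RingOfIntegers E)) (hv : ((ℓ' : ℕ) : NumberField.RingOfIntegers E) ∈ v.asIdeal), (Literature.NumberTheory.PAdicHodge.fontainePstAdicCompletion v ℓ' hv).IsDeRhamFramed (σ.toLocal v)) → (∀ (L : Type) [Field L] [NumberField L] [Algebra E L], (σ.restrictField L).toGaloisRep.IsIrreducible) → ∃ π : Literature.NumberTheory.Automorphic.CuspidalAutomorphicRepData m E hE, π.1.IsLAlgebraic ∧ ∀ᶠ v : IsDedekindDomain.HeightOneSpectrum (NumberField.RingOfIntegers E) in Filter.cofinite, SatakeFrobCompatibleAt ι' π.1 σ v) → ∀ (ℓ : ℕ) [Fact ℓ.Prime] (ι : PadicAlgCl ℓ ≃+* ℂ) (ρ : Literature.NumberTheory.GaloisRepresentations.FramedGaloisRep K (PadicAlgCl ℓ) n), ρ.toGaloisRep.IsIrreducible → ((∀ᶠ v : IsDedekindDomain.HeightOneSpectrum (NumberField.RingOfIntegers K) in Filter.cofinite, ρ.IsUnramifiedAt v) ∧ ∀ (v : IsDedekindDomain.HeightOneSpectrum (NumberField.RingOfIntegers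 K)) (hv : ((ℓ : ℕ) : NumberField.RingOfIntegers K) ∈ v.asIdeal), (Literature.NumberTheory.PAdicHodge.fontainePstAdicCompletion v ℓ hv).IsDeRhamFramed (ρ.toLocal v)) → (n = 5 ∧ ∃ (σ : Literature.NumberTheory.GaloisRepresentations.FramedGaloisRep K (PadicAlgCl ℓ) 4) (ψ ν : Literature.NumberTheory.GaloisRepresentations.FramedGaloisRep K (PadicAlgCl ℓ) 1), (σ.toGaloisRep.IsIrreducible ∧ ((∀ᶠ v : IsDedekindDomain.HeightOneSpectrum (NumberField.RingOfIntegers K) in Filter.cofinite, σ.IsUnramifiedAt v) ∧ ∀ (v : IsDedekindDomain.HeightOneSpectrum (NumberField.RingOfIntegers K)) (hv : ((ℓ : ℕ) : NumberField.RingOfIntegers K) ∈ v.asIdeal), (Literature.NumberTheory.PAdicHodge.fontainePstAdicCompletion v ℓ hv).IsDeRhamFramed (σ.toLocal v)) ∧ (∀ (L : Type) [Field L] [NumberField L] [Algebra K L], (σ.restrictField L).toGaloisRep.IsIrreducible)) ∧ ∀ g : Field.absoluteGaloisGroup K, (Literature.NumberTheory.GaloisRepresentations.FramedRep.charpoly ρ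 g).roots.map (fun x => Literature.NumberTheory.GaloisRepresentations.FramedRep.trace ψ g * x) + {Literature.NumberTheory.GaloisRepresentations.FramedRep.trace ν g} = ((Literature.NumberTheory.GaloisRepresentations.FramedRep.charpoly σ g).roots.powersetCard 2).map Multiset.prod) → ∃ π : Literature.NumberTheory.Automorphic.CuspidalAutomorphicRepData n K hcpt, π.1.IsLAlgebraic ∧ ∀ᶠ v : IsDedekindDomain.HeightOneSpectrum (NumberField.RingOfIntegers K) in Filter.cofinite, SatakeFrobCompatibleAt ι π.1 ρ v

/-- SD · crux 3 · WEAKER · UNDECIDED (self-dual connected type; instrumentable abelian-surface sub-locus).  GIVEN the rank-IH, clause (B) for the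
STD-box ρ that are NOT solvably a spin window and ARE of self-dual connected type. -/
def SelfDualTypeAutomorphy : Prop :=
  ∀ (K : Type) [Field K] [NumberField K] (n : ℕ) (hcpt : Literature.NumberTheory.Automorphic.isCompact_glFiniteIntegralLevel n K), 3 ≤ n → (∀ (m : ℕ), 2 ≤ m → m < n → ∀ (E : Type) [Field E] [NumberField E] (hE : Literature.NumberTheory.Automorphic.isCompact_glFiniteIntegralLevel m E) (ℓ' : ℕ) [Fact ℓ'.Prime] (ι' : PadicAlgCl ℓ' ≃+* ℂ) (σ : Literature.NumberTheory.GaloisRepresentations.FramedGaloisRep E (PadicAlgCl ℓ') m), σ.toGaloisRep.IsIrreducible → ((∀ᶠ v : IsDedekindDomain.HeightOneSpectrum (NumberField.RingOfIntegers E) in Filter.cofinite, σ.IsUnramifiedAt v) ∧ ∀ (v : IsDedekindDomain.HeightOneSpectrum (NumberField.RingOfIntegers E)) (hv : ((ℓ' : ℕ) : NumberField.RingOfIntegers E) ∈ v.asIdeal), (Literature.NumberTheory.PAdicHodge.fontainePstAdicCompletion v ℓ' hv).IsDeRhamFramed (σ.toLocal v)) → (∀ (L : Type) [Field L] [NumberField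 L] [Algebra E L], (σ.restrictField L).toGaloisRep.IsIrreducible) → ∃ π : Literature.NumberTheory.Automorphic.CuspidalAutomorphicRepData m E hE, π.1.IsLAlgebraic ∧ ∀ᶠ v : IsDedekindDomain.HeightOneSpectrum (NumberField.RingOfIntegers E) in Filter.cofinite, SatakeFrobCompatibleAt ι' π.1 σ v) → ∀ (ℓ : ℕ) [Fact ℓ.Prime] (ι : PadicAlgCl ℓ ≃+* ℂ) (ρ : Literature.NumberTheory.GaloisRepresentations.FramedGaloisRep K (PadicAlgCl ℓ) n), ρ.toGaloisRep.IsIrreducible → ((∀ᶠ v : IsDedekindDomain.HeightOneSpectrum (NumberField.RingOfIntegers K) in Filter.cofinite, ρ.IsUnramifiedAt v) ∧ ∀ (v : IsDedekindDomain.HeightOneSpectrum (NumberField.RingOfIntegers K)) (hv : ((ℓ : ℕ) : NumberField.RingOfIntegers K) ∈ v.asIdeal), (Literature.NumberTheory.PAdicHodge.fontainePstAdicCompletion v ℓ hv).IsDeRhamFramed (ρ.toLocal v)) → (∀ (L : Type) [Field L] [NumberField L] [Algebra K L], (ρ.restrictField L).toGaloisRep.IsIrreducible) → ¬ (∃ U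 : Set (Field.absoluteGaloisGroup K), IsOpen U ∧ (1 : Field.absoluteGaloisGroup K) ∈ U ∧ ∀ g ∈ U, ∃ c r : PadicAlgCl ℓ, Literature.NumberTheory.GaloisRepresentations.FramedRep.charpoly ρ g = ∏ j ∈ Finset.range n, (Polynomial.X - Polynomial.C (c * r ^ j))) → ¬ (∃ (E : Type) (_ : Field E) (_ : NumberField E) (_ : Algebra K E), IsGalois K E ∧ IsSolvable (E ≃ₐ[K] E) ∧ ((ρ.restrictField E).toGaloisRep.IsIrreducible ∧ ((∀ᶠ v : IsDedekindDomain.HeightOneSpectrum (NumberField.RingOfIntegers E) in Filter.cofinite, (ρ.restrictField E).IsUnramifiedAt v) ∧ ∀ (v : IsDedekindDomain.HeightOneSpectrum (NumberField.RingOfIntegers E)) (hv : ((ℓ : ℕ) : NumberField.RingOfIntegers E) ∈ v.asIdeal), (Literature.NumberTheory.PAdicHodge.fontainePstAdicCompletion v ℓ hv).IsDeRhamFramed ((ρ.restrictField E).toLocal v)) ∧ (∀ (L : Type) [Field L] [NumberField L] [Algebra E L], ((ρ.restrictField E).restrictField L).toGaloisRep.IsIrreducible) ∧ ¬ (∃ U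 : Set (Field.absoluteGaloisGroup E), IsOpen U ∧ (1 : Field.absoluteGaloisGroup E) ∈ U ∧ ∀ g ∈ U, ∃ c r : PadicAlgCl ℓ, Literature.NumberTheory.GaloisRepresentations.FramedRep.charpoly (ρ.restrictField E) g = ∏ j ∈ Finset.range n, (Polynomial.X - Polynomial.C (c * r ^ j)))) ∧ (∃ (a b : ℕ) (ρ₁ : Literature.NumberTheory.GaloisRepresentations.FramedGaloisRep E (PadicAlgCl ℓ) a) (ρ₂ : Literature.NumberTheory.GaloisRepresentations.FramedGaloisRep E (PadicAlgCl ℓ) b), 2 ≤ a ∧ 2 ≤ b ∧ n = a * b ∧ (ρ₁.toGaloisRep.IsIrreducible ∧ ((∀ᶠ v : IsDedekindDomain.HeightOneSpectrum (NumberField.RingOfIntegers E) in Filter.cofinite, ρ₁.IsUnramifiedAt v) ∧ ∀ (v : IsDedekindDomain.HeightOneSpectrum (NumberField.RingOfIntegers E)) (hv : ((ℓ : ℕ) : NumberField.RingOfIntegers E) ∈ v.asIdeal), (Literature.NumberTheory.PAdicHodge.fontainePstAdicCompletion v ℓ hv).IsDeRhamFramed (ρ₁.toLocal v)) ∧ (∀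 (L : Type) [Field L] [NumberField L] [Algebra E L], (ρ₁.restrictField L).toGaloisRep.IsIrreducible)) ∧ (ρ₂.toGaloisRep.IsIrreducible ∧ ((∀ᶠ v : IsDedekindDomain.HeightOneSpectrum (NumberField.RingOfIntegers E) in Filter.cofinite, ρ₂.IsUnramifiedAt v) ∧ ∀ (v : IsDedekindDomain.HeightOneSpectrum (NumberField.RingOfIntegers E)) (hv : ((ℓ : ℕ) : NumberField.RingOfIntegers E) ∈ v.asIdeal), (Literature.NumberTheory.PAdicHodge.fontainePstAdicCompletion v ℓ hv).IsDeRhamFramed (ρ₂.toLocal v)) ∧ (∀ (L : Type) [Field L] [NumberField L] [Algebra E L], (ρ₂.restrictField L).toGaloisRep.IsIrreducible)) ∧ ∀ g : Field.absoluteGaloisGroup E, Literature.NumberTheory.GaloisRepresentations.FramedRep.charpoly (ρ.restrictField E) g = (Matrix.kroneckerMap (· * ·) ((ρ₁ g : GL (Fin a) (PadicAlgCl ℓ)) : Matrix (Fin a) (Fin a) (PadicAlgCl ℓ)) ((ρ₂ g : GL (Fin b) (PadicAlgCl ℓ)) : Matrix (Fin b) (Fin b) (PadicAlgCl ℓ))).charpoly))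 → ((∀ U : Set (Field.absoluteGaloisGroup K), IsOpen U → (1 : Field.absoluteGaloisGroup K) ∈ U → ∃ g ∈ U, ∃ e : Fin n → PadicAlgCl ℓ, (Literature.NumberTheory.GaloisRepresentations.FramedRep.charpoly ρ g).roots = (Finset.univ : Finset (Fin n)).val.map e ∧ ∃ ij : Fin (n / 2) → Fin n × Fin n, ∀ a : Fin (n / 2) → ℤ, (∏ t : Fin (n / 2), (e (ij t).1 / e (ij t).2) ^ (a t)) = 1 → a = 0) ∧ ¬ (∃ (E : Type) (_ : Field E) (_ : NumberField E) (_ : Algebra K E), IsGalois K E ∧ IsSolvable (E ≃ₐ[K] E) ∧ (((ρ.restrictField E).toGaloisRep.IsIrreducible ∧ ((∀ᶠ v : IsDedekindDomain.HeightOneSpectrum (NumberField.RingOfIntegers E) in Filter.cofinite, (ρ.restrictField E).IsUnramifiedAt v) ∧ ∀ (v : IsDedekindDomain.HeightOneSpectrum (NumberField.RingOfIntegers E)) (hv : ((ℓ : ℕ) : NumberField.RingOfIntegers E) ∈ v.asIdeal), (Literature.NumberTheory.PAdicHodge.fontainePstAdicCompletion v ℓ hv).IsDeRhamFramed ((ρ.restrictField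 E).toLocal v)) ∧ (∀ (L : Type) [Field L] [NumberField L] [Algebra E L], ((ρ.restrictField E).restrictField L).toGaloisRep.IsIrreducible) ∧ ¬ (∃ U : Set (Field.absoluteGaloisGroup E), IsOpen U ∧ (1 : Field.absoluteGaloisGroup E) ∈ U ∧ ∀ g ∈ U, ∃ c r : PadicAlgCl ℓ, Literature.NumberTheory.GaloisRepresentations.FramedRep.charpoly (ρ.restrictField E) g = ∏ j ∈ Finset.range n, (Polynomial.X - Polynomial.C (c * r ^ j)))) ∧ ¬ (∃ (E' : Type) (_ : Field E') (_ : NumberField E') (_ : Algebra E E'), IsGalois E E' ∧ IsSolvable (E' ≃ₐ[E] E') ∧ (((ρ.restrictField E).restrictField E').toGaloisRep.IsIrreducible ∧ ((∀ᶠ v : IsDedekindDomain.HeightOneSpectrum (NumberField.RingOfIntegers E') in Filter.cofinite, ((ρ.restrictField E).restrictField E').IsUnramifiedAt v) ∧ ∀ (v : IsDedekindDomain.HeightOneSpectrum (NumberField.RingOfIntegers E')) (hv : ((ℓ : ℕ) : NumberField.RingOfIntegers E') ∈ v.asIdeal), (Literature.NumberTheory.PAdicHodge.fontainePstAdicCompletion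 v ℓ hv).IsDeRhamFramed (((ρ.restrictField E).restrictField E').toLocal v)) ∧ (∀ (L : Type) [Field L] [NumberField L] [Algebra E' L], (((ρ.restrictField E).restrictField E').restrictField L).toGaloisRep.IsIrreducible) ∧ ¬ (∃ U : Set (Field.absoluteGaloisGroup E'), IsOpen U ∧ (1 : Field.absoluteGaloisGroup E') ∈ U ∧ ∀ g ∈ U, ∃ c r : PadicAlgCl ℓ, Literature.NumberTheory.GaloisRepresentations.FramedRep.charpoly ((ρ.restrictField E).restrictField E') g = ∏ j ∈ Finset.range n, (Polynomial.X - Polynomial.C (c * r ^ j)))) ∧ (∃ (a b : ℕ) (ρ₁ : Literature.NumberTheory.GaloisRepresentations.FramedGaloisRep E' (PadicAlgCl ℓ) a) (ρ₂ : Literature.NumberTheory.GaloisRepresentations.FramedGaloisRep E' (PadicAlgCl ℓ) b), 2 ≤ a ∧ 2 ≤ b ∧ n = a * b ∧ (ρ₁.toGaloisRep.IsIrreducible ∧ ((∀ᶠ v : IsDedekindDomain.HeightOneSpectrum (NumberField.RingOfIntegers E') in Filter.cofinite, ρ₁.IsUnramifiedAt v) ∧ ∀ (v : IsDedekindDomain.HeightOneSpectrum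 (NumberField.RingOfIntegers E')) (hv : ((ℓ : ℕ) : NumberField.RingOfIntegers E') ∈ v.asIdeal), (Literature.NumberTheory.PAdicHodge.fontainePstAdicCompletion v ℓ hv).IsDeRhamFramed (ρ₁.toLocal v)) ∧ (∀ (L : Type) [Field L] [NumberField L] [Algebra E' L], (ρ₁.restrictField L).toGaloisRep.IsIrreducible)) ∧ (ρ₂.toGaloisRep.IsIrreducible ∧ ((∀ᶠ v : IsDedekindDomain.HeightOneSpectrum (NumberField.RingOfIntegers E') in Filter.cofinite, ρ₂.IsUnramifiedAt v) ∧ ∀ (v : IsDedekindDomain.HeightOneSpectrum (NumberField.RingOfIntegers E')) (hv : ((ℓ : ℕ) : NumberField.RingOfIntegers E') ∈ v.asIdeal), (Literature.NumberTheory.PAdicHodge.fontainePstAdicCompletion v ℓ hv).IsDeRhamFramed (ρ₂.toLocal v)) ∧ (∀ (L : Type) [Field L] [NumberField L] [Algebra E' L], (ρ₂.restrictField L).toGaloisRep.IsIrreducible)) ∧ ∀ g : Field.absoluteGaloisGroup E', Literature.NumberTheory.GaloisRepresentations.FramedRep.charpoly ((ρ.restrictField E).restrictField E') g = (Matrix.kroneckerMap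 (· * ·) ((ρ₁ g : GL (Fin a) (PadicAlgCl ℓ)) : Matrix (Fin a) (Fin a) (PadicAlgCl ℓ)) ((ρ₂ g : GL (Fin b) (PadicAlgCl ℓ)) : Matrix (Fin b) (Fin b) (PadicAlgCl ℓ))).charpoly))) ∧ (n = 6 ∧ ∃ (σ : Literature.NumberTheory.GaloisRepresentations.FramedGaloisRep E (PadicAlgCl ℓ) 4) (χ : Literature.NumberTheory.GaloisRepresentations.FramedGaloisRep E (PadicAlgCl ℓ) 1), (σ.toGaloisRep.IsIrreducible ∧ ((∀ᶠ v : IsDedekindDomain.HeightOneSpectrum (NumberField.RingOfIntegers E) in Filter.cofinite, σ.IsUnramifiedAt v) ∧ ∀ (v : IsDedekindDomain.HeightOneSpectrum (NumberField.RingOfIntegers E)) (hv : ((ℓ : ℕ) : NumberField.RingOfIntegers E) ∈ v.asIdeal), (Literature.NumberTheory.PAdicHodge.fontainePstAdicCompletion v ℓ hv).IsDeRhamFramed (σ.toLocal v)) ∧ (∀ (L : Type) [Field L] [NumberField L] [Algebra E L], (σ.restrictField L).toGaloisRep.IsIrreducible)) ∧ ((∀ᶠ v : IsDedekindDomain.HeightOneSpectrum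 (NumberField.RingOfIntegers E) in Filter.cofinite, χ.IsUnramifiedAt v) ∧ ∀ (v : IsDedekindDomain.HeightOneSpectrum (NumberField.RingOfIntegers E)) (hv : ((ℓ : ℕ) : NumberField.RingOfIntegers E) ∈ v.asIdeal), (Literature.NumberTheory.PAdicHodge.fontainePstAdicCompletion v ℓ hv).IsDeRhamFramed (χ.toLocal v)) ∧ ∀ g : Field.absoluteGaloisGroup E, (Literature.NumberTheory.GaloisRepresentations.FramedRep.charpoly (ρ.restrictField E) g).roots = (((Literature.NumberTheory.GaloisRepresentations.FramedRep.charpoly σ g).roots.powersetCard 2).map Multiset.prod).map (fun x => Literature.NumberTheory.GaloisRepresentations.FramedRep.trace χ g * x)))) → ¬ (∃ (E : Type) (_ : Field E) (_ : NumberField E) (_ : Algebra K E), IsGalois K E ∧ IsSolvable (E ≃ₐ[K] E) ∧ ((ρ.restrictField E).toGaloisRep.IsIrreducible ∧ ((∀ᶠ v : IsDedekindDomain.HeightOneSpectrum (NumberField.RingOfIntegers E) in Filter.cofinite, (ρ.restrictField E).IsUnramifiedAt v) ∧ ∀ (v : IsDedekindDomain.HeightOneSpectrum (NumberField.RingOfIntegers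 E)) (hv : ((ℓ : ℕ) : NumberField.RingOfIntegers E) ∈ v.asIdeal), (Literature.NumberTheory.PAdicHodge.fontainePstAdicCompletion v ℓ hv).IsDeRhamFramed ((ρ.restrictField E).toLocal v))) ∧ (n = 5 ∧ ∃ (σ : Literature.NumberTheory.GaloisRepresentations.FramedGaloisRep E (PadicAlgCl ℓ) 4) (ψ ν : Literature.NumberTheory.GaloisRepresentations.FramedGaloisRep E (PadicAlgCl ℓ) 1), (σ.toGaloisRep.IsIrreducible ∧ ((∀ᶠ v : IsDedekindDomain.HeightOneSpectrum (NumberField.RingOfIntegers E) in Filter.cofinite, σ.IsUnramifiedAt v) ∧ ∀ (v : IsDedekindDomain.HeightOneSpectrum (NumberField.RingOfIntegers E)) (hv : ((ℓ : ℕ) : NumberField.RingOfIntegers E) ∈ v.asIdeal), (Literature.NumberTheory.PAdicHodge.fontainePstAdicCompletion v ℓ hv).IsDeRhamFramed (σ.toLocal v)) ∧ (∀ (L : Type) [Field L] [NumberField L] [Algebra E L], (σ.restrictField L).toGaloisRep.IsIrreducible)) ∧ ∀ g : Field.absoluteGaloisGroup E, (Literature.NumberTheory.GaloisRepresentations.FramedRep.charpoly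 (ρ.restrictField E) g).roots.map (fun x => Literature.NumberTheory.GaloisRepresentations.FramedRep.trace ψ g * x) + {Literature.NumberTheory.GaloisRepresentations.FramedRep.trace ν g} = ((Literature.NumberTheory.GaloisRepresentations.FramedRep.charpoly σ g).roots.powersetCard 2).map Multiset.prod)) → (∃ U : Set (Field.absoluteGaloisGroup K), IsOpen U ∧ (1 : Field.absoluteGaloisGroup K) ∈ U ∧ ∃ J : Matrix (Fin n) (Fin n) (PadicAlgCl ℓ), IsUnit J.det ∧ ∀ g ∈ U, ∃ c : PadicAlgCl ℓ, (ρ g).val.transpose * J * (ρ g).val = c • J) → ∃ π : Literature.NumberTheory.Automorphic.CuspidalAutomorphicRepData n K hcpt, π.1.IsLAlgebraic ∧ ∀ᶠ v : IsDedekindDomain.HeightOneSpectrum (NumberField.RingOfIntegers K) in Filter.cofinite, SatakeFrobCompatibleAt ι π.1 ρ v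

/-- LIN · crux 4 · WEAKER · NEW DECLARED RESIDUAL · IDEA-NEEDED (linear connected type A_{n-1}: beyond twisted endoscopy by definition).  GIVEN
the rank-IH, clause (B) for the STD-box ρ that are NOT solvably a spin window and NOT of self-dual connected type. -/
def LinearTypeAutomorphy : Prop :=
  ∀ (K : Type) [Field K] [NumberField K] (n : ℕ) (hcpt : Literature.NumberTheory.Automorphic.isCompact_glFiniteIntegralLevel n K), 3 ≤ n → (∀ (m : ℕ), 2 ≤ m → m < n → ∀ (E : Type) [Field E] [NumberField E] (hE : Literature.NumberTheory.Automorphic.isCompact_glFiniteIntegralLevel m E) (ℓ' : ℕ) [Fact ℓ'.Prime] (ι' : PadicAlgCl ℓ' ≃+* ℂ) (σ : Literature.NumberTheory.GaloisRepresentations.FramedGaloisRep E (PadicAlgCl ℓ') m), σ.toGaloisRep.IsIrreducible → ((∀ᶠ v : IsDedekindDomain.HeightOneSpectrum (NumberField.RingOfIntegers E) in Filter.cofinite, σ.IsUnramifiedAt v) ∧ ∀ (v : IsDedekindDomain.HeightOneSpectrum (NumberField.RingOfIntegers E)) (hv : ((ℓ' : ℕ) : NumberField.RingOfIntegers E) ∈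 v.asIdeal), (Literature.NumberTheory.PAdicHodge.fontainePstAdicCompletion v ℓ' hv).IsDeRhamFramed (σ.toLocal v)) → (∀ (L : Type) [Field L] [NumberField L] [Algebra E L], (σ.restrictField L).toGaloisRep.IsIrreducible) → ∃ π : Literature.NumberTheory.Automorphic.CuspidalAutomorphicRepData m E hE, π.1.IsLAlgebraic ∧ ∀ᶠ v : IsDedekindDomain.HeightOneSpectrum (NumberField.RingOfIntegers E) in Filter.cofinite, SatakeFrobCompatibleAt ι' π.1 σ v) → ∀ (ℓ : ℕ) [Fact ℓ.Prime] (ι : PadicAlgCl ℓ ≃+* ℂ) (ρ : Literature.NumberTheory.GaloisRepresentations.FramedGaloisRep K (PadicAlgCl ℓ) n), ρ.toGaloisRep.IsIrreducible → ((∀ᶠ v : IsDedekindDomain.HeightOneSpectrum (NumberField.RingOfIntegers K) in Filter.cofinite, ρ.IsUnramifiedAt v) ∧ ∀ (v : IsDedekindDomain.HeightOneSpectrum (NumberField.RingOfIntegers K)) (hv : ((ℓ : ℕ) : NumberField.RingOfIntegers K) ∈ v.asIdeal), (Literature.NumberTheory.PAdicHodge.fontainePstAdicCompletion v ℓ hv).IsDeRhamFramed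 (ρ.toLocal v)) → (∀ (L : Type) [Field L] [NumberField L] [Algebra K L], (ρ.restrictField L).toGaloisRep.IsIrreducible) → ¬ (∃ U : Set (Field.absoluteGaloisGroup K), IsOpen U ∧ (1 : Field.absoluteGaloisGroup K) ∈ U ∧ ∀ g ∈ U, ∃ c r : PadicAlgCl ℓ, Literature.NumberTheory.GaloisRepresentations.FramedRep.charpoly ρ g = ∏ j ∈ Finset.range n, (Polynomial.X - Polynomial.C (c * r ^ j))) → ¬ (∃ (E : Type) (_ : Field E) (_ : NumberField E) (_ : Algebra K E), IsGalois K E ∧ IsSolvable (E ≃ₐ[K] E) ∧ ((ρ.restrictField E).toGaloisRep.IsIrreducible ∧ ((∀ᶠ v : IsDedekindDomain.HeightOneSpectrum (NumberField.RingOfIntegers E) in Filter.cofinite, (ρ.restrictField E).IsUnramifiedAt v) ∧ ∀ (v : IsDedekindDomain.HeightOneSpectrum (NumberField.RingOfIntegers E)) (hv : ((ℓ : ℕ) : NumberField.RingOfIntegers E) ∈ v.asIdeal), (Literature.NumberTheory.PAdicHodge.fontainePstAdicCompletion v ℓ hv).IsDeRhamFramed ((ρ.restrictField E).toLocal v)) ∧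 (∀ (L : Type) [Field L] [NumberField L] [Algebra E L], ((ρ.restrictField E).restrictField L).toGaloisRep.IsIrreducible) ∧ ¬ (∃ U : Set (Field.absoluteGaloisGroup E), IsOpen U ∧ (1 : Field.absoluteGaloisGroup E) ∈ U ∧ ∀ g ∈ U, ∃ c r : PadicAlgCl ℓ, Literature.NumberTheory.GaloisRepresentations.FramedRep.charpoly (ρ.restrictField E) g = ∏ j ∈ Finset.range n, (Polynomial.X - Polynomial.C (c * r ^ j)))) ∧ (∃ (a b : ℕ) (ρ₁ : Literature.NumberTheory.GaloisRepresentations.FramedGaloisRep E (PadicAlgCl ℓ) a) (ρ₂ : Literature.NumberTheory.GaloisRepresentations.FramedGaloisRep E (PadicAlgCl ℓ) b), 2 ≤ a ∧ 2 ≤ b ∧ n = a * b ∧ (ρ₁.toGaloisRep.IsIrreducible ∧ ((∀ᶠ v : IsDedekindDomain.HeightOneSpectrum (NumberField.RingOfIntegers E) in Filter.cofinite, ρ₁.IsUnramifiedAt v) ∧ ∀ (v : IsDedekindDomain.HeightOneSpectrum (NumberField.RingOfIntegers E)) (hv : ((ℓ : ℕ) : NumberField.RingOfIntegers E) ∈ v.asIdeal),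 (Literature.NumberTheory.PAdicHodge.fontainePstAdicCompletion v ℓ hv).IsDeRhamFramed (ρ₁.toLocal v)) ∧ (∀ (L : Type) [Field L] [NumberField L] [Algebra E L], (ρ₁.restrictField L).toGaloisRep.IsIrreducible)) ∧ (ρ₂.toGaloisRep.IsIrreducible ∧ ((∀ᶠ v : IsDedekindDomain.HeightOneSpectrum (NumberField.RingOfIntegers E) in Filter.cofinite, ρ₂.IsUnramifiedAt v) ∧ ∀ (v : IsDedekindDomain.HeightOneSpectrum (NumberField.RingOfIntegers E)) (hv : ((ℓ : ℕ) : NumberField.RingOfIntegers E) ∈ v.asIdeal), (Literature.NumberTheory.PAdicHodge.fontainePstAdicCompletion v ℓ hv).IsDeRhamFramed (ρ₂.toLocal v)) ∧ (∀ (L : Type) [Field L] [NumberField L] [Algebra E L], (ρ₂.restrictField L).toGaloisRep.IsIrreducible)) ∧ ∀ g : Field.absoluteGaloisGroup E, Literature.NumberTheory.GaloisRepresentations.FramedRep.charpoly (ρ.restrictField E) g = (Matrix.kroneckerMap (· * ·) ((ρ₁ g : GL (Fin a) (PadicAlgCl ℓ)) : Matrix (Fin a) (Fin a) (PadicAlgCl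 ℓ)) ((ρ₂ g : GL (Fin b) (PadicAlgCl ℓ)) : Matrix (Fin b) (Fin b) (PadicAlgCl ℓ))).charpoly)) → ((∀ U : Set (Field.absoluteGaloisGroup K), IsOpen U → (1 : Field.absoluteGaloisGroup K) ∈ U → ∃ g ∈ U, ∃ e : Fin n → PadicAlgCl ℓ, (Literature.NumberTheory.GaloisRepresentations.FramedRep.charpoly ρ g).roots = (Finset.univ : Finset (Fin n)).val.map e ∧ ∃ ij : Fin (n / 2) → Fin n × Fin n, ∀ a : Fin (n / 2) → ℤ, (∏ t : Fin (n / 2), (e (ij t).1 / e (ij t).2) ^ (a t)) = 1 → a = 0) ∧ ¬ (∃ (E : Type) (_ : Field E) (_ : NumberField E) (_ : Algebra K E), IsGalois K E ∧ IsSolvable (E ≃ₐ[K] E) ∧ (((ρ.restrictField E).toGaloisRep.IsIrreducible ∧ ((∀ᶠ v : IsDedekindDomain.HeightOneSpectrum (NumberField.RingOfIntegers E) in Filter.cofinite, (ρ.restrictField E).IsUnramifiedAt v) ∧ ∀ (v : IsDedekindDomain.HeightOneSpectrum (NumberField.RingOfIntegers E)) (hv : ((ℓ : ℕ) : NumberField.RingOfIntegers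 E) ∈ v.asIdeal), (Literature.NumberTheory.PAdicHodge.fontainePstAdicCompletion v ℓ hv).IsDeRhamFramed ((ρ.restrictField E).toLocal v)) ∧ (∀ (L : Type) [Field L] [NumberField L] [Algebra E L], ((ρ.restrictField E).restrictField L).toGaloisRep.IsIrreducible) ∧ ¬ (∃ U : Set (Field.absoluteGaloisGroup E), IsOpen U ∧ (1 : Field.absoluteGaloisGroup E) ∈ U ∧ ∀ g ∈ U, ∃ c r : PadicAlgCl ℓ, Literature.NumberTheory.GaloisRepresentations.FramedRep.charpoly (ρ.restrictField E) g = ∏ j ∈ Finset.range n, (Polynomial.X - Polynomial.C (c * r ^ j)))) ∧ ¬ (∃ (E' : Type) (_ : Field E') (_ : NumberField E') (_ : Algebra E E'), IsGalois E E' ∧ IsSolvable (E' ≃ₐ[E] E') ∧ (((ρ.restrictField E).restrictField E').toGaloisRep.IsIrreducible ∧ ((∀ᶠ v : IsDedekindDomain.HeightOneSpectrum (NumberField.RingOfIntegers E') in Filter.cofinite, ((ρ.restrictField E).restrictField E').IsUnramifiedAt v) ∧ ∀ (v : IsDedekindDomain.HeightOneSpectrum (NumberField.RingOfIntegers E'))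 (hv : ((ℓ : ℕ) : NumberField.RingOfIntegers E') ∈ v.asIdeal), (Literature.NumberTheory.PAdicHodge.fontainePstAdicCompletion v ℓ hv).IsDeRhamFramed (((ρ.restrictField E).restrictField E').toLocal v)) ∧ (∀ (L : Type) [Field L] [NumberField L] [Algebra E' L], (((ρ.restrictField E).restrictField E').restrictField L).toGaloisRep.IsIrreducible) ∧ ¬ (∃ U : Set (Field.absoluteGaloisGroup E'), IsOpen U ∧ (1 : Field.absoluteGaloisGroup E') ∈ U ∧ ∀ g ∈ U, ∃ c r : PadicAlgCl ℓ, Literature.NumberTheory.GaloisRepresentations.FramedRep.charpoly ((ρ.restrictField E).restrictField E') g = ∏ j ∈ Finset.range n, (Polynomial.X - Polynomial.C (c * r ^ j)))) ∧ (∃ (a b : ℕ) (ρ₁ : Literature.NumberTheory.GaloisRepresentations.FramedGaloisRep E' (PadicAlgCl ℓ) a) (ρ₂ : Literature.NumberTheory.GaloisRepresentations.FramedGaloisRep E' (PadicAlgCl ℓ) b), 2 ≤ a ∧ 2 ≤ b ∧ n = a * b ∧ (ρ₁.toGaloisRep.IsIrreducible ∧ ((∀ᶠ v : IsDedekindDomain.HeightOneSpectrum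 (NumberField.RingOfIntegers E') in Filter.cofinite, ρ₁.IsUnramifiedAt v) ∧ ∀ (v : IsDedekindDomain.HeightOneSpectrum (NumberField.RingOfIntegers E')) (hv : ((ℓ : ℕ) : NumberField.RingOfIntegers E') ∈ v.asIdeal), (Literature.NumberTheory.PAdicHodge.fontainePstAdicCompletion v ℓ hv).IsDeRhamFramed (ρ₁.toLocal v)) ∧ (∀ (L : Type) [Field L] [NumberField L] [Algebra E' L], (ρ₁.restrictField L).toGaloisRep.IsIrreducible)) ∧ (ρ₂.toGaloisRep.IsIrreducible ∧ ((∀ᶠ v : IsDedekindDomain.HeightOneSpectrum (NumberField.RingOfIntegers E') in Filter.cofinite, ρ₂.IsUnramifiedAt v) ∧ ∀ (v : IsDedekindDomain.HeightOneSpectrum (NumberField.RingOfIntegers E')) (hv : ((ℓ : ℕ) : NumberField.RingOfIntegers E') ∈ v.asIdeal), (Literature.NumberTheory.PAdicHodge.fontainePstAdicCompletion v ℓ hv).IsDeRhamFramed (ρ₂.toLocal v)) ∧ (∀ (L : Type) [Field L] [NumberField L] [Algebra E' L], (ρ₂.restrictField L).toGaloisRep.IsIrreducible)) ∧ ∀ g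 : Field.absoluteGaloisGroup E', Literature.NumberTheory.GaloisRepresentations.FramedRep.charpoly ((ρ.restrictField E).restrictField E') g = (Matrix.kroneckerMap (· * ·) ((ρ₁ g : GL (Fin a) (PadicAlgCl ℓ)) : Matrix (Fin a) (Fin a) (PadicAlgCl ℓ)) ((ρ₂ g : GL (Fin b) (PadicAlgCl ℓ)) : Matrix (Fin b) (Fin b) (PadicAlgCl ℓ))).charpoly))) ∧ (n = 6 ∧ ∃ (σ : Literature.NumberTheory.GaloisRepresentations.FramedGaloisRep E (PadicAlgCl ℓ) 4) (χ : Literature.NumberTheory.GaloisRepresentations.FramedGaloisRep E (PadicAlgCl ℓ) 1), (σ.toGaloisRep.IsIrreducible ∧ ((∀ᶠ v : IsDedekindDomain.HeightOneSpectrum (NumberField.RingOfIntegers E) in Filter.cofinite, σ.IsUnramifiedAt v) ∧ ∀ (v : IsDedekindDomain.HeightOneSpectrum (NumberField.RingOfIntegers E)) (hv : ((ℓ : ℕ) : NumberField.RingOfIntegers E) ∈ v.asIdeal), (Literature.NumberTheory.PAdicHodge.fontainePstAdicCompletion v ℓ hv).IsDeRhamFramed (σ.toLocal v)) ∧ (∀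 (L : Type) [Field L] [NumberField L] [Algebra E L], (σ.restrictField L).toGaloisRep.IsIrreducible)) ∧ ((∀ᶠ v : IsDedekindDomain.HeightOneSpectrum (NumberField.RingOfIntegers E) in Filter.cofinite, χ.IsUnramifiedAt v) ∧ ∀ (v : IsDedekindDomain.HeightOneSpectrum (NumberField.RingOfIntegers E)) (hv : ((ℓ : ℕ) : NumberField.RingOfIntegers E) ∈ v.asIdeal), (Literature.NumberTheory.PAdicHodge.fontainePstAdicCompletion v ℓ hv).IsDeRhamFramed (χ.toLocal v)) ∧ ∀ g : Field.absoluteGaloisGroup E, (Literature.NumberTheory.GaloisRepresentations.FramedRep.charpoly (ρ.restrictField E) g).roots = (((Literature.NumberTheory.GaloisRepresentations.FramedRep.charpoly σ g).roots.powersetCard 2).map Multiset.prod).map (fun x => Literature.NumberTheory.GaloisRepresentations.FramedRep.trace χ g * x)))) → ¬ (∃ (E : Type) (_ : Field E) (_ : NumberField E) (_ : Algebra K E), IsGalois K E ∧ IsSolvable (E ≃ₐ[K] E) ∧ ((ρ.restrictField E).toGaloisRep.IsIrreducible ∧ ((∀ᶠ v : IsDedekindDomain.HeightOneSpectrum (NumberField.RingOfIntegers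 E) in Filter.cofinite, (ρ.restrictField E).IsUnramifiedAt v) ∧ ∀ (v : IsDedekindDomain.HeightOneSpectrum (NumberField.RingOfIntegers E)) (hv : ((ℓ : ℕ) : NumberField.RingOfIntegers E) ∈ v.asIdeal), (Literature.NumberTheory.PAdicHodge.fontainePstAdicCompletion v ℓ hv).IsDeRhamFramed ((ρ.restrictField E).toLocal v))) ∧ (n = 5 ∧ ∃ (σ : Literature.NumberTheory.GaloisRepresentations.FramedGaloisRep E (PadicAlgCl ℓ) 4) (ψ ν : Literature.NumberTheory.GaloisRepresentations.FramedGaloisRep E (PadicAlgCl ℓ) 1), (σ.toGaloisRep.IsIrreducible ∧ ((∀ᶠ v : IsDedekindDomain.HeightOneSpectrum (NumberField.RingOfIntegers E) in Filter.cofinite, σ.IsUnramifiedAt v) ∧ ∀ (v : IsDedekindDomain.HeightOneSpectrum (NumberField.RingOfIntegers E)) (hv : ((ℓ : ℕ) : NumberField.RingOfIntegers E) ∈ v.asIdeal), (Literature.NumberTheory.PAdicHodge.fontainePstAdicCompletion v ℓ hv).IsDeRhamFramed (σ.toLocal v)) ∧ (∀ (L : Type) [Field L] [NumberField L] [Algebra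 E L], (σ.restrictField L).toGaloisRep.IsIrreducible)) ∧ ∀ g : Field.absoluteGaloisGroup E, (Literature.NumberTheory.GaloisRepresentations.FramedRep.charpoly (ρ.restrictField E) g).roots.map (fun x => Literature.NumberTheory.GaloisRepresentations.FramedRep.trace ψ g * x) + {Literature.NumberTheory.GaloisRepresentations.FramedRep.trace ν g} = ((Literature.NumberTheory.GaloisRepresentations.FramedRep.charpoly σ g).roots.powersetCard 2).map Multiset.prod)) → ¬ (∃ U : Set (Field.absoluteGaloisGroup K), IsOpen U ∧ (1 : Field.absoluteGaloisGroup K) ∈ U ∧ ∃ J : Matrix (Fin n) (Fin n) (PadicAlgCl ℓ), IsUnit J.det ∧ ∀ g ∈ U, ∃ c : PadicAlgCl ℓ, (ρ g).val.transpose * J * (ρ g).val = c • J) → ∃ π : Literature.NumberTheory.Automorphic.CuspidalAutomorphicRepData n K hcpt, π.1.IsLAlgebraic ∧ ∀ᶠ v : IsDedekindDomain.HeightOneSpectrum (NumberField.RingOfIntegers K) in Filter.cofinite, SatakeFrobCompatibleAt ι π.1 ρ v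

/-- FRAME′ · support · the HOST ROUTE below STD, as one implication BY NAME.  Certified from the host's `CartanRankSplit.closes` and the host items
(`frame_of_host`); trivially from Langlands. -/
def StandardTypeFrame : Prop :=
  Summit.Langlands.Langlands.Theses.CartanRankSplit.StandardTypeAutomorphy → _root_.Langlands

/-- documentation (NOT an item): the STD-exact window cell = STD VERBATIM + the K-rational spin window inserted; implied by ACC₅ (`exact_of_transport`)
and by STD (`cells_of_std'`). -/
def SpinWindowCellExact : Prop :=
  Summit.Langlands.Langlands.Theses.CartanRankSplit.SatakeAvatarExistence → ∀ (K : Type) [Field K] [NumberField K] (n : ℕ) (hcpt : Literature.NumberTheory.Automorphic.isCompact_glFiniteIntegralLevel n K), 3 ≤ n → (∀ (m : ℕ), 2 ≤ m → m < n → ∀ (E : Type) [Field E] [NumberField E] (hE : Literature.NumberTheory.Automorphic.isCompact_glFiniteIntegralLevel m E) (ℓ' : ℕ) [Fact ℓ'.Prime] (ι' : PadicAlgCl ℓ' ≃+* ℂ) (σ : Literature.NumberTheory.GaloisRepresentations.FramedGaloisRep E (PadicAlgCl ℓ') m), σ.toGaloisRep.IsIrreducible → ((∀ᶠ v : IsDedekindDomain.HeightOneSpectrum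 (NumberField.RingOfIntegers E) in Filter.cofinite, σ.IsUnramifiedAt v) ∧ ∀ (v : IsDedekindDomain.HeightOneSpectrum (NumberField.RingOfIntegers E)) (hv : ((ℓ' : ℕ) : NumberField.RingOfIntegers E) ∈ v.asIdeal), (Literature.NumberTheory.PAdicHodge.fontainePstAdicCompletion v ℓ' hv).IsDeRhamFramed (σ.toLocal v)) → (∀ (L : Type) [Field L] [NumberField L] [Algebra E L], (σ.restrictField L).toGaloisRep.IsIrreducible) → ∃ π : Literature.NumberTheory.Automorphic.CuspidalAutomorphicRepData m E hE, π.1.IsLAlgebraic ∧ ∀ᶠ v : IsDedekindDomain.HeightOneSpectrum (NumberField.RingOfIntegers E) in Filter.cofinite, SatakeFrobCompatibleAt ι' π.1 σ v) → ∀ (ℓ : ℕ) [Fact ℓ.Prime] (ι : PadicAlgCl ℓ ≃+* ℂ) (ρ : Literature.NumberTheory.GaloisRepresentations.FramedGaloisRep K (PadicAlgCl ℓ) n), ρ.toGaloisRep.IsIrreducible → ((∀ᶠ v : IsDedekindDomain.HeightOneSpectrum (NumberField.RingOfIntegers K) in Filter.cofinite, ρ.IsUnramifiedAt v) ∧ ∀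 (v : IsDedekindDomain.HeightOneSpectrum (NumberField.RingOfIntegers K)) (hv : ((ℓ : ℕ) : NumberField.RingOfIntegers K) ∈ v.asIdeal), (Literature.NumberTheory.PAdicHodge.fontainePstAdicCompletion v ℓ hv).IsDeRhamFramed (ρ.toLocal v)) → (∀ (L : Type) [Field L] [NumberField L] [Algebra K L], (ρ.restrictField L).toGaloisRep.IsIrreducible) → ¬ (∃ U : Set (Field.absoluteGaloisGroup K), IsOpen U ∧ (1 : Field.absoluteGaloisGroup K) ∈ U ∧ ∀ g ∈ U, ∃ c r : PadicAlgCl ℓ, Literature.NumberTheory.GaloisRepresentations.FramedRep.charpoly ρ g = ∏ j ∈ Finset.range n, (Polynomial.X - Polynomial.C (c * r ^ j))) → ¬ (∃ (E : Type) (_ : Field E) (_ : NumberField E) (_ : Algebra K E), IsGalois K E ∧ IsSolvable (E ≃ₐ[K] E) ∧ ((ρ.restrictField E).toGaloisRep.IsIrreducible ∧ ((∀ᶠ v : IsDedekindDomain.HeightOneSpectrum (NumberField.RingOfIntegers E) in Filter.cofinite, (ρ.restrictField E).IsUnramifiedAt v) ∧ ∀ (v : IsDedekindDomain.HeightOneSpectrum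 (NumberField.RingOfIntegers E)) (hv : ((ℓ : ℕ) : NumberField.RingOfIntegers E) ∈ v.asIdeal), (Literature.NumberTheory.PAdicHodge.fontainePstAdicCompletion v ℓ hv).IsDeRhamFramed ((ρ.restrictField E).toLocal v)) ∧ (∀ (L : Type) [Field L] [NumberField L] [Algebra E L], ((ρ.restrictField E).restrictField L).toGaloisRep.IsIrreducible) ∧ ¬ (∃ U : Set (Field.absoluteGaloisGroup E), IsOpen U ∧ (1 : Field.absoluteGaloisGroup E) ∈ U ∧ ∀ g ∈ U, ∃ c r : PadicAlgCl ℓ, Literature.NumberTheory.GaloisRepresentations.FramedRep.charpoly (ρ.restrictField E) g = ∏ j ∈ Finset.range n, (Polynomial.X - Polynomial.C (c * r ^ j)))) ∧ (∃ (a b : ℕ) (ρ₁ : Literature.NumberTheory.GaloisRepresentations.FramedGaloisRep E (PadicAlgCl ℓ) a) (ρ₂ : Literature.NumberTheory.GaloisRepresentations.FramedGaloisRep E (PadicAlgCl ℓ) b), 2 ≤ a ∧ 2 ≤ b ∧ n = a * b ∧ (ρ₁.toGaloisRep.IsIrreducible ∧ ((∀ᶠ v : IsDedekindDomain.HeightOneSpectrum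 (NumberField.RingOfIntegers E) in Filter.cofinite, ρ₁.IsUnramifiedAt v) ∧ ∀ (v : IsDedekindDomain.HeightOneSpectrum (NumberField.RingOfIntegers E)) (hv : ((ℓ : ℕ) : NumberField.RingOfIntegers E) ∈ v.asIdeal), (Literature.NumberTheory.PAdicHodge.fontainePstAdicCompletion v ℓ hv).IsDeRhamFramed (ρ₁.toLocal v)) ∧ (∀ (L : Type) [Field L] [NumberField L] [Algebra E L], (ρ₁.restrictField L).toGaloisRep.IsIrreducible)) ∧ (ρ₂.toGaloisRep.IsIrreducible ∧ ((∀ᶠ v : IsDedekindDomain.HeightOneSpectrum (NumberField.RingOfIntegers E) in Filter.cofinite, ρ₂.IsUnramifiedAt v) ∧ ∀ (v : IsDedekindDomain.HeightOneSpectrum (NumberField.RingOfIntegers E)) (hv : ((ℓ : ℕ) : NumberField.RingOfIntegers E) ∈ v.asIdeal), (Literature.NumberTheory.PAdicHodge.fontainePstAdicCompletion v ℓ hv).IsDeRhamFramed (ρ₂.toLocal v)) ∧ (∀ (L : Type) [Field L] [NumberField L] [Algebra E L], (ρ₂.restrictField L).toGaloisRep.IsIrreducible)) ∧ ∀ g :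 Field.absoluteGaloisGroup E, Literature.NumberTheory.GaloisRepresentations.FramedRep.charpoly (ρ.restrictField E) g = (Matrix.kroneckerMap (· * ·) ((ρ₁ g : GL (Fin a) (PadicAlgCl ℓ)) : Matrix (Fin a) (Fin a) (PadicAlgCl ℓ)) ((ρ₂ g : GL (Fin b) (PadicAlgCl ℓ)) : Matrix (Fin b) (Fin b) (PadicAlgCl ℓ))).charpoly)) → ((∀ U : Set (Field.absoluteGaloisGroup K), IsOpen U → (1 : Field.absoluteGaloisGroup K) ∈ U → ∃ g ∈ U, ∃ e : Fin n → PadicAlgCl ℓ, (Literature.NumberTheory.GaloisRepresentations.FramedRep.charpoly ρ g).roots = (Finset.univ : Finset (Fin n)).val.map e ∧ ∃ ij : Fin (n / 2) → Fin n × Fin n, ∀ a : Fin (n / 2) → ℤ, (∏ t : Fin (n / 2), (e (ij t).1 / e (ij t).2) ^ (a t)) = 1 → a = 0) ∧ ¬ (∃ (E : Type) (_ : Field E) (_ : NumberField E) (_ : Algebra K E), IsGalois K E ∧ IsSolvable (E ≃ₐ[K] E) ∧ (((ρ.restrictField E).toGaloisRep.IsIrreducible ∧ ((∀ᶠ v :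 IsDedekindDomain.HeightOneSpectrum (NumberField.RingOfIntegers E) in Filter.cofinite, (ρ.restrictField E).IsUnramifiedAt v) ∧ ∀ (v : IsDedekindDomain.HeightOneSpectrum (NumberField.RingOfIntegers E)) (hv : ((ℓ : ℕ) : NumberField.RingOfIntegers E) ∈ v.asIdeal), (Literature.NumberTheory.PAdicHodge.fontainePstAdicCompletion v ℓ hv).IsDeRhamFramed ((ρ.restrictField E).toLocal v)) ∧ (∀ (L : Type) [Field L] [NumberField L] [Algebra E L], ((ρ.restrictField E).restrictField L).toGaloisRep.IsIrreducible) ∧ ¬ (∃ U : Set (Field.absoluteGaloisGroup E), IsOpen U ∧ (1 : Field.absoluteGaloisGroup E) ∈ U ∧ ∀ g ∈ U, ∃ c r : PadicAlgCl ℓ, Literature.NumberTheory.GaloisRepresentations.FramedRep.charpoly (ρ.restrictField E) g = ∏ j ∈ Finset.range n, (Polynomial.X - Polynomial.C (c * r ^ j)))) ∧ ¬ (∃ (E' : Type) (_ : Field E') (_ : NumberField E') (_ : Algebra E E'), IsGalois E E' ∧ IsSolvable (E' ≃ₐ[E] E') ∧ (((ρ.restrictField E).restrictField E').toGaloisRep.IsIrreducible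 ∧ ((∀ᶠ v : IsDedekindDomain.HeightOneSpectrum (NumberField.RingOfIntegers E') in Filter.cofinite, ((ρ.restrictField E).restrictField E').IsUnramifiedAt v) ∧ ∀ (v : IsDedekindDomain.HeightOneSpectrum (NumberField.RingOfIntegers E')) (hv : ((ℓ : ℕ) : NumberField.RingOfIntegers E') ∈ v.asIdeal), (Literature.NumberTheory.PAdicHodge.fontainePstAdicCompletion v ℓ hv).IsDeRhamFramed (((ρ.restrictField E).restrictField E').toLocal v)) ∧ (∀ (L : Type) [Field L] [NumberField L] [Algebra E' L], (((ρ.restrictField E).restrictField E').restrictField L).toGaloisRep.IsIrreducible) ∧ ¬ (∃ U : Set (Field.absoluteGaloisGroup E'), IsOpen U ∧ (1 : Field.absoluteGaloisGroup E') ∈ U ∧ ∀ g ∈ U, ∃ c r : PadicAlgCl ℓ, Literature.NumberTheory.GaloisRepresentations.FramedRep.charpoly ((ρ.restrictField E).restrictField E') g = ∏ j ∈ Finset.range n, (Polynomial.X - Polynomial.C (c * r ^ j)))) ∧ (∃ (a b : ℕ) (ρ₁ : Literature.NumberTheory.GaloisRepresentations.FramedGaloisRep E' (PadicAlgCl ℓ)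 a) (ρ₂ : Literature.NumberTheory.GaloisRepresentations.FramedGaloisRep E' (PadicAlgCl ℓ) b), 2 ≤ a ∧ 2 ≤ b ∧ n = a * b ∧ (ρ₁.toGaloisRep.IsIrreducible ∧ ((∀ᶠ v : IsDedekindDomain.HeightOneSpectrum (NumberField.RingOfIntegers E') in Filter.cofinite, ρ₁.IsUnramifiedAt v) ∧ ∀ (v : IsDedekindDomain.HeightOneSpectrum (NumberField.RingOfIntegers E')) (hv : ((ℓ : ℕ) : NumberField.RingOfIntegers E') ∈ v.asIdeal), (Literature.NumberTheory.PAdicHodge.fontainePstAdicCompletion v ℓ hv).IsDeRhamFramed (ρ₁.toLocal v)) ∧ (∀ (L : Type) [Field L] [NumberField L] [Algebra E' L], (ρ₁.restrictField L).toGaloisRep.IsIrreducible)) ∧ (ρ₂.toGaloisRep.IsIrreducible ∧ ((∀ᶠ v : IsDedekindDomain.HeightOneSpectrum (NumberField.RingOfIntegers E') in Filter.cofinite, ρ₂.IsUnramifiedAt v) ∧ ∀ (v : IsDedekindDomain.HeightOneSpectrum (NumberField.RingOfIntegers E')) (hv : ((ℓ : ℕ) : NumberField.RingOfIntegers E') ∈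 v.asIdeal), (Literature.NumberTheory.PAdicHodge.fontainePstAdicCompletion v ℓ hv).IsDeRhamFramed (ρ₂.toLocal v)) ∧ (∀ (L : Type) [Field L] [NumberField L] [Algebra E' L], (ρ₂.restrictField L).toGaloisRep.IsIrreducible)) ∧ ∀ g : Field.absoluteGaloisGroup E', Literature.NumberTheory.GaloisRepresentations.FramedRep.charpoly ((ρ.restrictField E).restrictField E') g = (Matrix.kroneckerMap (· * ·) ((ρ₁ g : GL (Fin a) (PadicAlgCl ℓ)) : Matrix (Fin a) (Fin a) (PadicAlgCl ℓ)) ((ρ₂ g : GL (Fin b) (PadicAlgCl ℓ)) : Matrix (Fin b) (Fin b) (PadicAlgCl ℓ))).charpoly))) ∧ (n = 6 ∧ ∃ (σ : Literature.NumberTheory.GaloisRepresentations.FramedGaloisRep E (PadicAlgCl ℓ) 4) (χ : Literature.NumberTheory.GaloisRepresentations.FramedGaloisRep E (PadicAlgCl ℓ) 1), (σ.toGaloisRep.IsIrreducible ∧ ((∀ᶠ v : IsDedekindDomain.HeightOneSpectrum (NumberField.RingOfIntegers E) in Filter.cofinite, σ.IsUnramifiedAt v) ∧ ∀ (v : IsDedekindDomain.HeightOneSpectrum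 (NumberField.RingOfIntegers E)) (hv : ((ℓ : ℕ) : NumberField.RingOfIntegers E) ∈ v.asIdeal), (Literature.NumberTheory.PAdicHodge.fontainePstAdicCompletion v ℓ hv).IsDeRhamFramed (σ.toLocal v)) ∧ (∀ (L : Type) [Field L] [NumberField L] [Algebra E L], (σ.restrictField L).toGaloisRep.IsIrreducible)) ∧ ((∀ᶠ v : IsDedekindDomain.HeightOneSpectrum (NumberField.RingOfIntegers E) in Filter.cofinite, χ.IsUnramifiedAt v) ∧ ∀ (v : IsDedekindDomain.HeightOneSpectrum (NumberField.RingOfIntegers E)) (hv : ((ℓ : ℕ) : NumberField.RingOfIntegers E) ∈ v.asIdeal), (Literature.NumberTheory.PAdicHodge.fontainePstAdicCompletion v ℓ hv).IsDeRhamFramed (χ.toLocal v)) ∧ ∀ g : Field.absoluteGaloisGroup E, (Literature.NumberTheory.GaloisRepresentations.FramedRep.charpoly (ρ.restrictField E) g).roots = (((Literature.NumberTheory.GaloisRepresentations.FramedRep.charpoly σ g).roots.powersetCard 2).map Multiset.prod).map (fun x => Literature.NumberTheory.GaloisRepresentations.FramedRep.trace χ g * x)))) → (n = 5 ∧ ∃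 (σ : Literature.NumberTheory.GaloisRepresentations.FramedGaloisRep K (PadicAlgCl ℓ) 4) (ψ ν : Literature.NumberTheory.GaloisRepresentations.FramedGaloisRep K (PadicAlgCl ℓ) 1), (σ.toGaloisRep.IsIrreducible ∧ ((∀ᶠ v : IsDedekindDomain.HeightOneSpectrum (NumberField.RingOfIntegers K) in Filter.cofinite, σ.IsUnramifiedAt v) ∧ ∀ (v : IsDedekindDomain.HeightOneSpectrum (NumberField.RingOfIntegers K)) (hv : ((ℓ : ℕ) : NumberField.RingOfIntegers K) ∈ v.asIdeal), (Literature.NumberTheory.PAdicHodge.fontainePstAdicCompletion v ℓ hv).IsDeRhamFramed (σ.toLocal v)) ∧ (∀ (L : Type) [Field L] [NumberField L] [Algebra K L], (σ.restrictField L).toGaloisRep.IsIrreducible)) ∧ ∀ g : Field.absoluteGaloisGroup K, (Literature.NumberTheory.GaloisRepresentations.FramedRep.charpoly ρ g).roots.map (fun x => Literature.NumberTheory.GaloisRepresentations.FramedRep.trace ψ g * x) + {Literature.NumberTheory.GaloisRepresentations.FramedRep.trace ν g} = ((Literature.NumberTheory.GaloisRepresentations.FramedRep.charpoly σ g).roots.powersetCard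 2).map Multiset.prod) → ∃ π : Literature.NumberTheory.Automorphic.CuspidalAutomorphicRepData n K hcpt, π.1.IsLAlgebraic ∧ ∀ᶠ v : IsDedekindDomain.HeightOneSpectrum (NumberField.RingOfIntegers K) in Filter.cofinite, SatakeFrobCompatibleAt ι π.1 ρ v

/-! ## 5. Identity of the items with the structured forms (`Iff.rfl` ×4) and of the dedup binders with the host / grand-host (`Iff.rfl` ×2) -/

/-- ACC₅ item text ≡ its structured form (W⁺ → head over the K-rational spin window). -/
theorem spinWindowTransport_iff : SpinWindowTransport ↔ (CartanRankSplit.SatakeAvatarExistence →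
    ∀ (K : Type) [Field K] [NumberField K] (n : ℕ) (hcpt : Literature.NumberTheory.Automorphic.isCompact_glFiniteIntegralLevel n K), 3 ≤ n → RankIH n →
      ∀ (ℓ : ℕ) [Fact ℓ.Prime] (ι : PadicAlgCl ℓ ≃+* ℂ) (ρ : Literature.NumberTheory.GaloisRepresentations.FramedGaloisRep K (PadicAlgCl ℓ) n), ρ.toGaloisRep.IsIrreducible → PinnedGeometric ρ →
        IsRationalSpinWindow ρ → WeakAutomorphic hcpt ι ρ) := Iff.rfl

/-- SD item text ≡ its structured form (STD-box ∧ ¬ solvably spin window ∧ self-dual connected type). -/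
theorem selfDualTypeAutomorphy_iff : SelfDualTypeAutomorphy ↔
    ∀ (K : Type) [Field K] [NumberField K] (n : ℕ) (hcpt : Literature.NumberTheory.Automorphic.isCompact_glFiniteIntegralLevel n K), 3 ≤ n → RankIH n →
      ∀ (ℓ : ℕ) [Fact ℓ.Prime] (ι : PadicAlgCl ℓ ≃+* ℂ) (ρ : Literature.NumberTheory.GaloisRepresentations.FramedGaloisRep K (PadicAlgCl ℓ) n), ρ.toGaloisRep.IsIrreducible → PinnedGeometric ρ →
        IsLieIrreducible ρ → ¬ HasProgressionSpectra ρ → ¬ IsSolvablyKronecker ρ → (HasRatioRankAtLeast ρ (n / 2) ∧ ¬ IsSolvablyExteriorSquare ρ) →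
          ¬ IsSolvablySpinWindow ρ → IsOfSelfDualType ρ → WeakAutomorphic hcpt ι ρ := Iff.rfl

/-- LIN item text ≡ its structured form (STD-box ∧ ¬ solvably spin window ∧ ¬ self-dual connected type). -/
theorem linearTypeAutomorphy_iff : LinearTypeAutomorphy ↔
    ∀ (K : Type) [Field K] [NumberField K] (n : ℕ) (hcpt : Literature.NumberTheory.Automorphic.isCompact_glFiniteIntegralLevel n K), 3 ≤ n → RankIH n →
      ∀ (ℓ : ℕ) [Fact ℓ.Prime] (ι : PadicAlgCl ℓ ≃+* ℂ) (ρ : Literature.NumberTheory.GaloisRepresentations.FramedGaloisRep K (PadicAlgCl ℓ) n), ρ.toGaloisRep.IsIrreducible → PinnedGeometric ρ →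
        IsLieIrreducible ρ → ¬ HasProgressionSpectra ρ → ¬ IsSolvablyKronecker ρ → (HasRatioRankAtLeast ρ (n / 2) ∧ ¬ IsSolvablyExteriorSquare ρ) →
          ¬ IsSolvablySpinWindow ρ → ¬ IsOfSelfDualType ρ → WeakAutomorphic hcpt ι ρ := Iff.rfl

/-- documentation def `SpinWindowCellExact` ≡ its structured form (STD-box ∧ K-rational spin window, given W⁺). -/
theorem spinWindowCellExact_iff : SpinWindowCellExact ↔ (CartanRankSplit.SatakeAvatarExistence →
    ∀ (K : Type) [Field K] [NumberField K] (n : ℕ) (hcpt : Literature.NumberTheory.Automorphic.isCompact_glFiniteIntegralLevel n K), 3 ≤ n → RankIH n →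
      ∀ (ℓ : ℕ) [Fact ℓ.Prime] (ι : PadicAlgCl ℓ ≃+* ℂ) (ρ : Literature.NumberTheory.GaloisRepresentations.FramedGaloisRep K (PadicAlgCl ℓ) n), ρ.toGaloisRep.IsIrreducible → PinnedGeometric ρ →
        IsLieIrreducible ρ → ¬ HasProgressionSpectra ρ → ¬ IsSolvablyKronecker ρ → (HasRatioRankAtLeast ρ (n / 2) ∧ ¬ IsSolvablyExteriorSquare ρ) →
          IsRationalSpinWindow ρ → WeakAutomorphic hcpt ι ρ) := Iff.rfl

/-- the host's W⁺ decl is the grand-host's (hence `MonodromyDichotomy.SatakeAvatarExistence`, stmt-Langlands-17415), definitionally. -/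
theorem wplus_iff_host : CartanRankSplit.SatakeAvatarExistence ↔ KroneckerPrimitivitySplit.SatakeAvatarExistence := Iff.rfl

/-- the host's CSD decl is the grand-host's (hence `HolomorphicLimitSplit.CliffordSolvableDescent`, stmt-Langlands-31695), definitionally. -/
theorem csd_iff_host : CartanRankSplit.CliffordSolvableDescent ↔ KroneckerPrimitivitySplit.CliffordSolvableDescent := Iff.rfl

/-! ## 6. Kernels -/

/-- STD ⟹ each bulk cell (SD and LIN are STD with TWO extra hypotheses): OUTRIGHT. -/
theorem cells_of_std (hS : CartanRankSplit.StandardTypeAutomorphy) : SelfDualTypeAutomorphy ∧ LinearTypeAutomorphy :=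
  ⟨fun K _ _ n hcpt h3 hIH ℓ _ ι ρ hirr hgeo hLie hPS hSK hstd _ _ => hS K n hcpt h3 hIH ℓ ι ρ hirr hgeo hLie hPS hSK hstd,
   fun K _ _ n hcpt h3 hIH ℓ _ ι ρ hirr hgeo hLie hPS hSK hstd _ _ => hS K n hcpt h3 hIH ℓ ι ρ hirr hgeo hLie hPS hSK hstd⟩

/-- STD ⟹ the STD-exact window cell: OUTRIGHT. -/
theorem cells_of_std' (hS : CartanRankSplit.StandardTypeAutomorphy) : SpinWindowCellExact :=
  fun _ K _ _ n hcpt h3 hIH ℓ _ ι ρ hirr hgeo hLie hPS hSK hstd _ => hS K n hcpt h3 hIH ℓ ι ρ hirr hgeo hLie hPS hSK hstd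

/-- ACC₅ ⟹ the STD-exact window cell (ACC₅ asks less). -/
theorem exact_of_transport (h : SpinWindowTransport) : SpinWindowCellExact :=
  fun hW K _ _ n hcpt h3 hIH ℓ _ ι ρ hirr hgeo _ _ _ _ hX => h hW K n hcpt h3 hIH ℓ ι ρ hirr hgeo hX

/-- **the cells ⟹ STD modulo (W⁺ ∧ CSD)**: excluded middle on the SOLVABLE spin-window dial; on the window run ACC₅ over E on ρ|_E (the rank-IH is
field-universal and passes through; W⁺ is handed over; irreducibility and pinned-geometricity of ρ|_E are part of the dial) and descend the weak automorphy E → K by CSD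
fed with W⁺ (ϑ := ρ|_E, rank-0 complement); off the window, excluded middle on the form dial over K: SD or LIN verbatim.  (= `childroute.glue.lean`.) -/
theorem std_of_cells (hW : CartanRankSplit.SatakeAvatarExistence) (hCSD : CartanRankSplit.CliffordSolvableDescent)
    (hacc : SpinWindowTransport) (hsd : SelfDualTypeAutomorphy) (hlin : LinearTypeAutomorphy) :
    CartanRankSplit.StandardTypeAutomorphy := by
  intro K _ _ n hcpt h3 hIH ℓ _ ι ρ hirr hgeo hLie hPS hSK hstd
  by_cases hd : IsSolvablySpinWindow ρ
  · obtain ⟨E, _, _, _, hGal, hSolv, ⟨hirrE, hgeoE⟩, hX⟩ := hd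
    have hn : 0 < n := by omega
    have autE : ∀ hcptE : Literature.NumberTheory.Automorphic.isCompact_glFiniteIntegralLevel n E, WeakAutomorphic hcptE ι (ρ.restrictField E) := fun hcptE =>
      hacc hW E n hcptE h3 hIH ℓ ι (ρ.restrictField E) hirrE hgeoE hX
    exact hCSD hW K n ℓ ι ρ hirr hgeo hn E hGal hSolv n (ρ.restrictField E) hirrE (trace_restrictField_eq_add_zero ρ E) hn autE hcpt
  · by_cases hf : IsOfSelfDualType ρ
    · exact hsd K n hcpt h3 hIH ℓ ι ρ hirr hgeo hLie hPS hSK hstd hd hf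
    · exact hlin K n hcpt h3 hIH ℓ ι ρ hirr hgeo hLie hPS hSK hstd hd hf

/-- **EXACTNESS at the target, as far as the hypothesis-minimal ACC₅ allows**: modulo (W⁺ ∧ CSD), (ACC₅ ∧ SD ∧ LIN) ⟹ STD ⟹ (ACC₅↾STD ∧ SD ∧ LIN). -/
theorem std_sandwich (hW : CartanRankSplit.SatakeAvatarExistence) (hCSD : CartanRankSplit.CliffordSolvableDescent) :
    (SpinWindowTransport ∧ SelfDualTypeAutomorphy ∧ LinearTypeAutomorphy → CartanRankSplit.StandardTypeAutomorphy) ∧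
      (CartanRankSplit.StandardTypeAutomorphy → SpinWindowCellExact ∧ SelfDualTypeAutomorphy ∧ LinearTypeAutomorphy) :=
  ⟨fun h => std_of_cells hW hCSD h.1 h.2.1 h.2.2, fun h => ⟨cells_of_std' h, cells_of_std h⟩⟩

/-- **THE FRAME IS THE HOST ROUTE**: the host items ACC, SMALL, CSD, W⁺, FRAME (BY NAME) ⟹ (STD → Langlands), through the host's certified
`CartanRankSplit.closes`. -/
theorem frame_of_host (hacc : CartanRankSplit.AccidentalWindowTransport) (hsmall : CartanRankSplit.SmallTypeTransport)
    (hCSD : CartanRankSplit.CliffordSolvableDescent) (hW : CartanRankSplit.SatakeAvatarExistence) (hF : CartanRankSplit.TensorPrimitiveFrame) :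
    StandardTypeFrame := fun hstd =>
  CartanRankSplit.closes hacc hsmall hstd hCSD hW hF

/-- … and FRAME is the GRAND-HOST route KroneckerPrimitivitySplit rev 0 (its items BY NAME, through `KroneckerPrimitivitySplit.closes` — the landed twin's
`frame_of_host`): the frame spelled down to the grand-host's open items. -/
theorem frame_of_grandhost (hlow : KroneckerPrimitivitySplit.LowRankKroneckerTransport) (hhigh : KroneckerPrimitivitySplit.HigherKroneckerTransport) (hFH : KroneckerPrimitivitySplit.HigherLieRankFrame)
    (hacc : CartanRankSplit.AccidentalWindowTransport) (hsmall : CartanRankSplit.SmallTypeTransport)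
    (hCSD : CartanRankSplit.CliffordSolvableDescent) (hW : CartanRankSplit.SatakeAvatarExistence) : StandardTypeFrame :=
  frame_of_host hacc hsmall hCSD hW (Summit.Langlands.Langlands.Theorems.MonodromyDichotomyCartanRank.frame_of_host hlow hhigh hCSD hW hFH)

/-- the frame is (trivially) implied by the summit. -/
theorem frame_of_langlands (h : _root_.Langlands) : StandardTypeFrame := fun _ => h

/-- NECESSITY: STD is implied by the summit (clause (B) at a reciprocity datum, conjunct 1 of `Corresponds`). -/
theorem std_of_langlands (h : _root_.Langlands) : CartanRankSplit.StandardTypeAutomorphy := by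
  intro K _ _ n hcpt h3 _ ℓ _ ι ρ hirr hgeo _ _ _ _
  obtain ⟨⟨𝓡⟩, h𝓡⟩ := h K
  obtain ⟨π, hL, hcorr⟩ := (h𝓡 𝓡 n (by omega) hcpt).2 ℓ ι ρ hirr hgeo
  exact ⟨π, hL, hcorr.1⟩

/-- NECESSITY of the hypothesis-minimal ACC₅: directly from the summit (its head IS clause (B)'s: irreducible ∧ pinned-geometric). -/
theorem spinWindowTransport_of_langlands (h : _root_.Langlands) : SpinWindowTransport := by
  intro _ K _ _ n hcpt h3 _ ℓ _ ι ρ hirr hgeo _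
  obtain ⟨⟨𝓡⟩, h𝓡⟩ := h K
  obtain ⟨π, hL, hcorr⟩ := (h𝓡 𝓡 n (by omega) hcpt).2 ℓ ι ρ hirr hgeo
  exact ⟨π, hL, hcorr.1⟩

/-- … and of the bulk cells (no strengthening anywhere). -/
theorem selfDualTypeAutomorphy_of_langlands (h : _root_.Langlands) : SelfDualTypeAutomorphy :=
  (cells_of_std (std_of_langlands h)).1
/-- LIN is implied by the summit (necessity of the declared residual). -/
theorem linearTypeAutomorphy_of_langlands (h : _root_.Langlands) : LinearTypeAutomorphy :=
  (cells_of_std (std_of_langlands h)).2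

/-- W⁺ is implied by the summit (clause (A): an IRREDUCIBLE avatar with a.e. Satake compatibility). -/
theorem wplus_of_langlands (h : _root_.Langlands) : CartanRankSplit.SatakeAvatarExistence := by
  intro K _ _ n hcpt hn π hπ ℓ _ ι
  obtain ⟨⟨𝓡⟩, h𝓡⟩ := h K
  obtain ⟨ρ, hirr, _, hcorr, _⟩ := (h𝓡 𝓡 n hn hcpt).1 π hπ ℓ ι
  exact ⟨ρ, hirr, hcorr.1⟩

/-- CSD is implied by the summit (its conclusion is clause (B) for ρ over K; the descent hypotheses are not needed). -/
theorem csd_of_langlands (h : _root_.Langlands) : CartanRankSplit.CliffordSolvableDescent := by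
  intro _ K _ _ n ℓ _ ι ρ hirr hgeo hn E _ _ _ _ _ m ϑ _ _ _ _ hcpt
  obtain ⟨⟨𝓡⟩, h𝓡⟩ := h K
  obtain ⟨π, hL, hcorr⟩ := (h𝓡 𝓡 n hn hcpt).2 ℓ ι ρ hirr hgeo
  exact ⟨π, hL, hcorr.1⟩

/-- **DECIDING THEOREM of the child route** (= `childroute.glue.lean` VERBATIM up to the frame application): the three cells, CSD, W⁺ and the
frame ⟹ `_root_.Langlands` BY NAME. -/
theorem closes (hacc : SpinWindowTransport) (hsd : SelfDualTypeAutomorphy) (hlin : LinearTypeAutomorphy)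
    (hCSD : CartanRankSplit.CliffordSolvableDescent) (hW : CartanRankSplit.SatakeAvatarExistence) (hF : StandardTypeFrame) : _root_.Langlands :=
  hF (std_of_cells hW hCSD hacc hsd hlin)

/-- the deciding theorem with the HOST ITEMS in place of the frame (what the child route decides, spelled over the host route's open items). -/
theorem closes_host_shape (hacc6 : CartanRankSplit.AccidentalWindowTransport) (hsmall : CartanRankSplit.SmallTypeTransport)
    (hCSD : CartanRankSplit.CliffordSolvableDescent) (hW : CartanRankSplit.SatakeAvatarExistence) (hFT : CartanRankSplit.TensorPrimitiveFrame)
    (hacc : SpinWindowTransport) (hsd : SelfDualTypeAutomorphy) (hlin : LinearTypeAutomorphy) : _root_.Langlands :=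
  closes hacc hsd hlin hCSD hW (frame_of_host hacc6 hsmall hCSD hW hFT)

/-- **EXACTNESS of the child route, mod NOTHING**: Langlands ⟺ (ACC₅ ∧ SD ∧ LIN) ∧ CSD ∧ W⁺ ∧ FRAME′. -/
theorem langlands_iff_pieces : _root_.Langlands ↔
    (SpinWindowTransport ∧ SelfDualTypeAutomorphy ∧ LinearTypeAutomorphy) ∧ CartanRankSplit.CliffordSolvableDescent ∧
      CartanRankSplit.SatakeAvatarExistence ∧ StandardTypeFrame :=
  ⟨fun h => ⟨⟨spinWindowTransport_of_langlands h, cells_of_std (std_of_langlands h)⟩, csd_of_langlands h, wplus_of_langlands h, frame_of_langlands h⟩,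
   fun h => closes h.1.1 h.1.2.1 h.1.2.2 h.2.1 h.2.2.1 h.2.2.2⟩

-- the rank-IH every cell carries is itself implied by the summit (no cell is vacuously true under Langlands by a false antecedent):
-- LANDED as `Summit.Langlands.Langlands.Theorems.MonodromyDichotomyCartanRank.rankIH_of_langlands'` (dedup: reuse that declaration by name).

/-! ## 7. Consistency of the two dials with the host dials (documentation lemmas, kernel-checked shape facts) -/

/-- the K-rational spin window forces rank 5. -/
theorem rank_of_isRationalSpinWindow {K : Type} [Field K] [NumberField K] {ℓ : ℕ} [Fact ℓ.Prime] {n : ℕ}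
    (ρ : Literature.NumberTheory.GaloisRepresentations.FramedGaloisRep K (PadicAlgCl ℓ) n) (h : IsRationalSpinWindow ρ) : n = 5 := h.1

/-- … hence so does the solvable one (the rank does not change under restriction). -/
theorem rank_of_isSolvablySpinWindow {K : Type} [Field K] [NumberField K] {ℓ : ℕ} [Fact ℓ.Prime] {n : ℕ}
    (ρ : Literature.NumberTheory.GaloisRepresentations.FramedGaloisRep K (PadicAlgCl ℓ) n) (h : IsSolvablySpinWindow ρ) : n = 5 := by
  obtain ⟨E, _, _, _, _, _, _, hX⟩ := h
  exact hX.1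

/-- at rank 5, STD's «not solvably an exterior square» clause holds automatically (g13's window needs rank 6) … -/
theorem not_isSolvablyExteriorSquare_rank_five {K : Type} [Field K] [NumberField K] {ℓ : ℕ} [Fact ℓ.Prime]
    (ρ : Literature.NumberTheory.GaloisRepresentations.FramedGaloisRep K (PadicAlgCl ℓ) 5) : ¬ IsSolvablyExteriorSquare ρ := by
  rintro ⟨E, _, _, _, _, _, _, hX⟩
  exact absurd hX.1 (by decide)

/-- … and so does «not solvably Kronecker» (5 is not a product of two integers ≥ 2): the window cell needs neither as a hypothesis. -/
theorem not_isSolvablyKronecker_rank_five {K : Type} [Field K] [NumberField K] {ℓ : ℕ} [Fact ℓ.Prime]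
    (ρ : Literature.NumberTheory.GaloisRepresentations.FramedGaloisRep K (PadicAlgCl ℓ) 5) : ¬ IsSolvablyKronecker ρ := by
  rintro ⟨E, _, _, _, _, _, _, a, b, ρ₁, ρ₂, ha, hb, hn, _⟩
  have h2 : a * 2 ≤ a * b := Nat.mul_le_mul_left a hb
  obtain rfl : a = 2 := by omega
  omega

/-- the solvable window dial CONTAINS the irreducibility and pinned-geometricity of the restriction (so ACC₅ applies over the witness field with no
heredity lemma). -/
theorem acc5_head_of_isSolvablySpinWindow {K : Type} [Field K] [NumberField K] {ℓ : ℕ} [Fact ℓ.Prime] {n : ℕ}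
    (ρ : Literature.NumberTheory.GaloisRepresentations.FramedGaloisRep K (PadicAlgCl ℓ) n) (h : IsSolvablySpinWindow ρ) :
    ∃ (E : Type) (_ : Field E) (_ : NumberField E) (_ : Algebra K E), IsGalois K E ∧ IsSolvable (E ≃ₐ[K] E) ∧
      (ρ.restrictField E).toGaloisRep.IsIrreducible ∧ PinnedGeometric (ρ.restrictField E) ∧ IsRationalSpinWindow (ρ.restrictField E) := by
  obtain ⟨E, _, _, _, hG, hS, ⟨hi, hp⟩, hX⟩ := h
  exact ⟨E, inferInstance, inferInstance, inferInstance, hG, hS, hi, hp, hX⟩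

end Summit.Langlands.Langlands.Theorems.MonodromyDichotomyInvariantForm
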